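import Summits.AtomisticToContinuum.BoseEinsteinCondensation.Theses.BECConjugateDomination
import Literature.MathematicalPhysics.QuantumManyBody.LangevinGenerator

/-!
# Line `fisher-gaussian-density-mode` — crux `BECConjugateDomination.InfraredMinimumUncertainty`
(stmt-AtomisticToContinuum-11784) · skeleton, crux-plan **gen 2** (round 1) · **lead reshape r1**
(prover-line-stmt-AtomisticToContinuum-11784-0, 2026-08-16)

**Lead reshape r1 (what changed vs the planner's gen-2 file).** The hardest stub
`stub_phaseFisherDomination` (FD, `∃ φ continuous, 16ν_m ≤ C·J_m(φ)`) is CUT into four registered stubs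
whose composition is proved here (`fisherDominationV_of_parts`, `fisherTestV_eq_stein`):
`stub_steinIdentity` (provable now: the by-parts / Stein form `Re∫φ̄(Z)WΨ̄ = ‖k‖²Re∫(N∂φ(Z) − ∂̄φ(Z)Z̄⁽²⁾)|Ψ|²`
for real periodic `C¹` states and `C¹` fields — it makes `J_m(φ)` a functional of the joint law of
`(ρ_k, ρ_{2k})` with NO derivative of `Ψ`), `stub_weakEulerLagrange` (provable now: the weak
eigen-equation of a finite-energy `C¹` periodic minimiser — the first-gap-resolution input that
Disproof.lean §C shows every proof must use), `stub_coherenceRegular` (provable now: `g` continuous,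
`0 < g ≤ 1 = g(0)`, even, periodic — so `log g` and `ν_m` are genuine), and the lead's own core stub
`stub_phaseSteinDomination` (FD in Stein form with a `C¹` witness field, under the crux hypotheses plus
the conclusions of the two previous stubs). `stub_densityFisherGaussianity` (FG) is unchanged. The
composition `InfraredMinimumUncertainty_of` is still the only theorem concluding the route decl by name;
5 `sorry`s = the 5 registered stubs. New objects: `wirtingerD`, `wirtingerDbar`, `densityModeSq`,
`steinPairing`, `steinFunctional`; new named statements `SteinIdentity`, `WeakEulerLagrange`,
`CoherenceRegular`, `PhaseSteinDomination` (bodies = the stub signatures verbatim).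

Idea card `fisher-gaussian-density-mode` (crux-ideate r1, ideator 1; triage r1-1: pass, "merge with
`density-moment-domination` into ONE conjugate-proxy ladder"). This file supersedes the gen-1 skeleton
(same path; gen-1 stubs `stub_fisherDomination` / `stub_fisherGaussianity` over the planar-divergence
functional `fisherTest` are RETIRED — see "What changed in gen 2" below).

**The crux** (fixed; `Theses.BECConjugateDomination.InfraredMinimumUncertainty`). For the positive
minimiser `Ψ` of the periodic `N = n+1`-body energy on the torus of side `L = (N/ρ)^{1/3}` and every
mode `m ≠ 0` (`k = 2πm/L`, units `ħ = 2m = 1`):  `Π_m := N · ν_m · S_m ≤ C`, uniformly in `N` and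
`ρ < ρ₀`, where `ν_m = Re ĉ_m(log g)` is the Lévy weight of the translation-averaged coherence `g` and
`S_m = N⁻¹ E_{Ψ²}|Z_m|²` the (uncentred) static structure factor of the density mode
`Z_m(X) = ∑ⱼ e_m(xⱼ)`.

**The line (gen 2 typing).** Let `W_m := ([H, ρ_k]Ψ)(X) = ∑ⱼ e_m(xⱼ)(‖k‖²Ψ − 2i ∂_{xⱼ·k}Ψ)`
(`commutatorAmp`; only first derivatives of the `C¹` state, no junk), `m₂ := ∫|W_m|² = ‖[H,ρ_k]Ψ‖²`
(`secondMoment`), and let `σ := −2W/(N‖k‖²Ψ)` be the SCORE OF `Ψ²` ALONG THE DENSITY-WAVE (f-sum)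
LIFT `V` of the planar translations of `Z_m` (`E_{Ψ²}|σ|² = 4m₂/(N²‖k‖⁴)` identically). For a test
field `φ : ℂ → ℂ` the LIFTED FISHER TEST FUNCTIONAL is
  `J_m(φ) := 2 E[Re(φ̄(Z)σ)] − E|φ(Z)|² = −(4/(N‖k‖²)) Re∫ φ̄(Z) W Ψ̄ − ∫ |φ(Z)|²|Ψ|²`   (`fisherTestV`),
so that `sup_φ J_m = E|E[σ | Z_m]|² =: I^V(Z_m)`, the Fisher information of the law of the density mode
computed through the lift (for a `C¹` field and a real state, periodic integration by parts gives the
derivative-free form `J_m(φ) = −4 Re E[∂φ(Z)] + (4/N) Re E[ρ̄_{2k} ∂̄φ(Z)] − E|φ(Z)|²`: a functional of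
the JOINT LAW of the first two harmonics `(ρ_k, ρ_{2k})` only). The ladder, all rungs in this file:

* `FisherDominationV`    (FD, registered `stub_phaseFisherDomination`, the HARDEST):
  `∃ φ continuous, 16 ν_m ≤ C · J_m(φ)` — the Lévy (phase) weight is dominated by the Fisher
  information of the conjugate density mode ("minimum uncertainty up to `C`": `⟨p²⟩ ↦ ν`,
  Heisenberg ↦ Cramér–Rao). NECESSARY: with the linear field `φ = −λz`, `J = 4λ − λ²·N S_m` by the
  f-sum identity `Re∫ Z̄ W Ψ̄ = N‖k‖²` (`FSumIdentity`, periodic by parts), so IMU(C₀) ⇒ FD(4C₀+4)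
  (`fisherDomination_of_imu`). Bogoliubov: `C = 1` sharp as `k → 0` (FD(1) = the QuarterLaw).
* `FisherGaussianityV`   (FG, registered `stub_densityFisherGaussianity`, the residual):
  `∀ φ continuous, J_m(φ) · (N S_m) ≤ C'` — `I^V(Z_m) · E|Z_m|² ≤ C'`: the density mode is Gaussian IN
  FISHER METRIC at its own scale (`= 4` exactly for the free gas at every `N`, and for a centred
  isotropic complex Gaussian).
* Composition (sorry-free): `imu_of_fisher`, `InfraredMinimumUncertainty_of` —
  `16 ν (N S) ≤ C J(φ)(N S) ≤ C C'`, so `Π ≤ C C'/16`.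
* FALLBACK (moment) cut, typed and glued here, NOT registered: `DensityMomentDomination` (DMD,
  `4N²‖k‖⁴ ν_m ≤ C m₂`, the sibling card's waypoint; FD ⇒ DMD PROVED, `densityMoment_of_fisherDomination`,
  from the exact data-processing rung `J_m(φ) ≤ 4m₂/(N²‖k‖⁴)`, `fisherTestV_le_secondMoment`, PROVED),
  `FeynmanSaturation` (FS, `(N S_m)·m₂ ≤ C N²‖k‖⁴`, i.e. `m₀m₂ ≤ C m₁²`: single-mode saturation up to
  `C`; FS ⇒ FG PROVED), `SecondMomentBound` (SMB, `m₂ ≤ C N‖k‖³√(‖k‖²+ρ)`, Puff–Hölder) and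
  `StructureFactorCeiling` (SFC, `S_m ≤ C‖k‖/√(‖k‖²+ρ)`); SMB ∧ SFC ⇒ FS and DMD ∧ FS ⇒ IMU PROVED
  (`feynmanSaturation_of_moments`, `imu_of_densityMoment`, `imu_of_moments`). Strength bookkeeping
  (TRIAGE-r1-1 LADDER, now kernel-checked): IMU ⇒ FD ⇒ DMD on the phase side, FG ⇐ FS ⇐ SMB ∧ SFC on
  the density side; the non-dominated stub sets are {FD, FG} (registered), {DMD, FS}, {DMD, SMB, SFC} —
  the lead may re-register either fallback by copying the certified inline forms at the end of this
  file into `theorem stub_… := by sorry` and composing with the proved glue (one edit).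

**What changed in gen 2 (vs gen 1, same slug).** (1) `fisherTest` (true planar divergence, `C¹`
fields) ↦ `fisherTestV` (lifted score form, continuous fields): the true marginal Fisher information of
`Z_m` is `+∞` for `N ≤ 5` (caustics of the Kluyver map) and its data-processing comparison with `m₂`
holds only up to Gram-matrix corrections near the collinear-phase set; the lifted functional is finite
for every `N`, satisfies `J ≤ 4m₂/(N²‖k‖⁴)` EXACTLY (pointwise AM–GM, proved) and keeps Cramér–Rao
(`J(−λz) = 4λ − λ²NS`). (2) Stub signatures are SELF-CONTAINED (`let`s over tree declarations, exactly
like the crux), so a stub worker can restate them verbatim in a `Theorems/` file with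
`open Literature.MathematicalPhysics.QuantumManyBody.BoseGas`; the named `Prop`s of this file are
certified equal to the inline forms (`…_iff_inline`, `Iff.rfl`). (3) The whole ladder of the merged
line is typed and glued (gen 1 had it in prose). (4) Necessity now rests on ONE calculus identity
(`FSumIdentity`, the f-sum rule `⟨ρ_k†[H,ρ_k]⟩ = N‖k‖²` for real periodic `C¹` states).

Heuristic calibration (physics, not used in proofs): Bogoliubov `m₂ = N‖k‖³√(‖k‖²+16πρa)`,
`S = ‖k‖/√(‖k‖²+16πρa)` (SMB, SFC, FS with `C = max(1, (16πa)^{±1/2})`, exact single-mode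
saturation), `I^V·NS = 4`, `16ν = 4Π·I^V` with `Π ↑ ¼`; free gas: `ν = 0`, `W = ‖k‖²ΨZ`, `σ = −(2/N)Z`
is `Z`-measurable, `I^V·NS = 4` at every `N`; `d = 1` Tonks/CUE: `Π = ¼` at leading order, FS holds
(p–h continuum width `O(k²)`).
-/

noncomputable section

open MeasureTheory Filter Set Metric
open scoped ENNReal NNReal Topology ComplexConjugate BigOperators

namespace Summit.AtomisticToContinuum.BoseEinsteinCondensation.Cruxes.InfraredMinimumUncertainty.FisherGaussianDensityMode

open Literature.MathematicalPhysics.QuantumManyBody.BoseGas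
open Summit.AtomisticToContinuum.BoseEinsteinCondensation.Theses.BECConjugateDomination
  (InfraredMinimumUncertainty)

/-! ## The objects (bodies of `coherence`/`levyWeight`/`structureFactor` are the crux's `let`s verbatim) -/

/-- The wave vector `k = 2π m / L ∈ ℝ³` of the mode `m ∈ ℤ³` (`‖k‖ = kn m` of `PuffFloor`). -/
def waveVec (L : ℝ) (m : Fin 3 → ℤ) : Space :=
  (2 * Real.pi / L) • latticeVec 1 m

/-- The density mode (collective coordinate) `Z_m(X) = ∑ⱼ e_m(xⱼ) ∈ ℂ`, `e_m(x) = e^{2πi m·x/L}`. -/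
def densityMode (N : ℕ) (L : ℝ) (m : Fin 3 → ℤ) (X : Config N) : ℂ :=
  ∑ j : Fin N, cellWave L m (X j)

/-- The **commutator amplitude** `W_m(X) = ([H, ρ_k]Ψ)(X) = ∑ⱼ e_m(xⱼ) (‖k‖² Ψ(X) − 2i ∂_{xⱼ·k}Ψ(X))`
(`H = −∑Δⱼ + V`, the potential commutes with `ρ_k = Z_m`; `[−Δⱼ, e^{ik·xⱼ}] = e^{ik·xⱼ}(‖k‖² − 2ik·∇ⱼ)`).
Only FIRST derivatives of the `C¹` amplitude enter: no junk for any trial state. For the ground state,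
`W_m = (H − E₀)(Z_m Ψ)`. -/
def commutatorAmp (N : ℕ) (L : ℝ) (ψ : Config N → ℂ) (m : Fin 3 → ℤ) (X : Config N) : ℂ :=
  ∑ j : Fin N, cellWave L m (X j) *
    (((‖waveVec L m‖ ^ 2 : ℝ) : ℂ) * ψ X - 2 * Complex.I * fderiv ℝ ψ X (Pi.single j (waveVec L m)))

/-- The second energy-weighted moment of the density response, `m₂ = ‖[H, ρ_k]Ψ‖² = ∫_{cell^N} |W_m|²`
(for a normalised state; `= ∫ ω² S(k, ω) dω · N`; f-sum `m₁ = N‖k‖²`, `m₀ = N S_m`). Bogoliubov: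
`m₂ = N‖k‖³ √(‖k‖² + 16πρa)`; free gas: `m₂ = N‖k‖⁴`. -/
def secondMoment (N : ℕ) (L : ℝ) (ψ : Config N → ℂ) (m : Fin 3 → ℤ) : ℝ :=
  ∫ X in cellN N L, ‖commutatorAmp N L ψ m X‖ ^ 2

/-- The translation-averaged one-body coherence `g(r) = ∫_cell dx ∫_{cell^n} dY |Ψ(x+r,Y)| |Ψ(x,Y)|`
(`= ρ⁻¹ ×` averaged one-body density matrix; `g(0) = 1`, `g(r) = N⁻¹∑_p n_p e^{ip·r}`). The crux's `let g`. -/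
def coherence (n : ℕ) (L : ℝ) (Ψ : PeriodicTrialState (n + 1) L) (r : Space) : ℝ :=
  ∫ x in cell L, ∫ Y in cellN n L, ‖Ψ.ψ (Matrix.vecCons (x + r) Y)‖ * ‖Ψ.ψ (Matrix.vecCons x Y)‖

/-- The Lévy weight `ν_m = Re ĉ_m(log g)` (`−log g(r) = ∑_{m≠0} ν_m (1 − cos k·r)`). The crux's `let ν`. -/
def levyWeight (n : ℕ) (L : ℝ) (Ψ : PeriodicTrialState (n + 1) L) (m : Fin 3 → ℤ) : ℝ :=
  (cellFourierCoeff L (fun r : Space => ((Real.log (coherence n L Ψ r) : ℝ) : ℂ)) m).re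

/-- The (uncentred) static structure factor `S_m = N⁻¹ ∫_{cell^N} |Z_m|² |Ψ|²`. The crux's `let S`. -/
def structureFactor (n : ℕ) (L : ℝ) (Ψ : PeriodicTrialState (n + 1) L) (m : Fin 3 → ℤ) : ℝ :=
  ((n : ℝ) + 1)⁻¹ * ∫ X in cellN (n + 1) L, ‖∑ j : Fin (n + 1), cellWave L m (X j)‖ ^ 2 * ‖Ψ.ψ X‖ ^ 2

/-- The **lifted Fisher test functional** of the density mode `Z_m` under `|Ψ|² dX`, at the test field
`φ : ℂ → ℂ`:
`J_m(φ) = −(4/(N‖k‖²)) Re ∫ φ̄(Z_m) W_m Ψ̄ dX − ∫ |φ(Z_m)|² |Ψ|² dX = 2E[Re(φ̄(Z)σ)] − E|φ(Z)|²`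
with `σ = −2W/(N‖k‖²Ψ)` the score of `Ψ²` along the density-wave lift. Pointwise AM–GM gives
`J_m(φ) ≤ E|σ|² = 4m₂/(N²‖k‖⁴)` for EVERY `φ` (`fisherTestV_le_secondMoment`), and
`sup_φ J_m = E|E[σ|Z]|²`: "`∃ φ, a ≤ C·J(φ)`" renders `a ≤ C·I^V(Z_m)`, "`∀ φ, J(φ)·b ≤ C`" renders
`I^V(Z_m)·b ≤ C` — no supremum, no density, finite at every `N`. -/
def fisherTestV (n : ℕ) (L : ℝ) (Ψ : PeriodicTrialState (n + 1) L) (m : Fin 3 → ℤ) (φ : ℂ → ℂ) : ℝ :=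
  -(4 / (((n : ℝ) + 1) * ‖waveVec L m‖ ^ 2)) *
      (∫ X in cellN (n + 1) L, (starRingEnd ℂ (φ (densityMode (n + 1) L m X)) *
        commutatorAmp (n + 1) L Ψ.ψ m X * starRingEnd ℂ (Ψ.ψ X)).re) -
    ∫ X in cellN (n + 1) L, ‖φ (densityMode (n + 1) L m X)‖ ^ 2 * ‖Ψ.ψ X‖ ^ 2

/-! ## Wirtinger derivatives and the Stein (derivative-free) form of the lifted Fisher functional
(lead reshape r1, 2026-08-16) -/

/-- The Wirtinger derivative `∂φ(z) = ½(∂ₓφ − i∂_yφ)` of a real-differentiable field `φ : ℂ → ℂ`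
(`∂ₓφ = Dφ(z)·1`, `∂_yφ = Dφ(z)·i`; `0`-junk where `φ` is not differentiable). -/
def wirtingerD (φ : ℂ → ℂ) (z : ℂ) : ℂ :=
  (fderiv ℝ φ z 1 - Complex.I * fderiv ℝ φ z Complex.I) / 2

/-- The conjugate Wirtinger derivative `∂̄φ(z) = ½(∂ₓφ + i∂_yφ)`. -/
def wirtingerDbar (φ : ℂ → ℂ) (z : ℂ) : ℂ :=
  (fderiv ℝ φ z 1 + Complex.I * fderiv ℝ φ z Complex.I) / 2

/-- The second harmonic of the density mode, `Z^{(2)}_m(X) = ∑ⱼ e_m(xⱼ)² = ∑ⱼ e_{2m}(xⱼ) = ρ_{2k}`. -/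
def densityModeSq (N : ℕ) (L : ℝ) (m : Fin 3 → ℤ) (X : Config N) : ℂ :=
  ∑ j : Fin N, cellWave L m (X j) ^ 2

/-- The **Stein pairing** `R_m(φ) = Re ∫ (N ∂φ(Z_m) − ∂̄φ(Z_m) Z̄^{(2)}_m) |Ψ|² dX` — the derivative-free
form of the commutator pairing: for a real periodic `C¹` state and a `C¹` field,
`Re ∫ φ̄(Z) W Ψ̄ = ‖k‖² R_m(φ)` (`SteinIdentity`, registered stub `stub_steinIdentity`). -/
def steinPairing (n : ℕ) (L : ℝ) (Ψ : PeriodicTrialState (n + 1) L) (m : Fin 3 → ℤ) (φ : ℂ → ℂ) : ℝ :=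
  ∫ X in cellN (n + 1) L,
    ((((n : ℝ) + 1 : ℝ) : ℂ) * wirtingerD φ (densityMode (n + 1) L m X) -
        wirtingerDbar φ (densityMode (n + 1) L m X) *
          starRingEnd ℂ (densityModeSq (n + 1) L m X)).re * ‖Ψ.ψ X‖ ^ 2

/-- The **Stein form of the lifted Fisher test functional**,
`J^S_m(φ) = −(4/N) R_m(φ) − E|φ(Z_m)|² = −4 Re E[∂φ(Z)] + (4/N) Re E[Z̄^{(2)} ∂̄φ(Z)] − E|φ(Z)|²`:
a functional of the JOINT LAW of the first two harmonics `(ρ_k, ρ_{2k})` under `|Ψ|²dX` only (no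
derivative of `Ψ`). Equals `fisherTestV` on `C¹` fields for real states (`fisherTestV_eq_stein`). -/
def steinFunctional (n : ℕ) (L : ℝ) (Ψ : PeriodicTrialState (n + 1) L) (m : Fin 3 → ℤ) (φ : ℂ → ℂ) : ℝ :=
  -(4 / ((n : ℝ) + 1)) * steinPairing n L Ψ m φ -
    ∫ X in cellN (n + 1) L, ‖φ (densityMode (n + 1) L m X)‖ ^ 2 * ‖Ψ.ψ X‖ ^ 2


/-! ## The crux frame and the named statements of the ladder -/

/-- The quantifier frame of the crux: for every smooth-class `v` (repulsive finite range, finite, `C²`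
as `ṽ(x) = v(|x|)`, edge condition `‖D²ṽ‖ ≤ Cₑ√ṽ`) there are `C ≥ 0`, `ρ₀ > 0` such that for
`0 < ρ < ρ₀`, all large `N = n+1` and every positive minimiser `Ψ` on the torus of side `(N/ρ)^{1/3}`
(`periodicEnergy = E₀^per < ∞`, `Ψ = |Ψ| ≠ 0` pointwise — the crux's four curried hypotheses verbatim),
`P C ρ n Ψ`. -/
def CruxFrame (P : ℝ → ∀ (ρ : ℝ) (n : ℕ), PeriodicTrialState (n + 1) (sideLength ρ (n + 1)) → Prop) :
    Prop :=
  ∀ v : ℝ → ℝ≥0∞, IsRepulsiveFiniteRange v → (∀ r, v r ≠ ⊤) →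
    ContDiff ℝ 2 (fun x : Space => (v ‖x‖).toReal) →
    (∃ Cₑ : ℝ, ∀ x : Space,
      ‖iteratedFDeriv ℝ 2 (fun x : Space => (v ‖x‖).toReal) x‖ ≤ Cₑ * Real.sqrt ((v ‖x‖).toReal)) →
    ∃ C : ℝ, 0 ≤ C ∧ ∃ ρ₀ : ℝ, 0 < ρ₀ ∧ ∀ ρ : ℝ, 0 < ρ → ρ < ρ₀ → ∀ᶠ n : ℕ in atTop,
      ∀ Ψ : PeriodicTrialState (n + 1) (sideLength ρ (n + 1)),
        periodicEnergy v Ψ = periodicGroundStateEnergy v (n + 1) (sideLength ρ (n + 1)) →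
        periodicEnergy v Ψ ≠ ⊤ → (∀ X, Ψ.ψ X = (‖Ψ.ψ X‖ : ℂ)) → (∀ X, Ψ.ψ X ≠ 0) → P C ρ n Ψ

/-- **FD — Fisher domination of the Lévy weight** (registered as `stub_phaseFisherDomination`, the
HARDEST stub; open-problem strength, NECESSARY for the crux): `∃ φ continuous, 16 ν_m ≤ C·J_m(φ)`, i.e.
`16 ν_m ≤ C · I^V(Z_m)`. Heuristics: Bogoliubov `C = 1` sharp as `k → 0`; `v ≡ 0`: `ν = 0`;
IMU(C₀) ⇒ FD(4C₀+4) (`fisherDomination_of_imu`); FD(C) ⇒ DMD(C) (`densityMoment_of_fisherDomination`).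
Why it might fail / why it is hard: it is still an `n₀`-free infrared UPPER law (FD ⇒ DMD ⇒ with SMB
the all-mode `1/|k|` law for `ν_k`), BEC strength; with the optimal LINEAR field it collapses to IMU,
so any proof of FD that is not a proof of IMU tests the law of `Z_m` with NONLINEAR fields (the
optimal one is `E[σ | Z_m]`, the twisted score of the 2-D marginal). -/
def FisherDominationV : Prop :=
  CruxFrame fun C ρ n Ψ => ∀ m : Fin 3 → ℤ, m ≠ 0 → ∃ φ : ℂ → ℂ, Continuous φ ∧
    16 * levyWeight n (sideLength ρ (n + 1)) Ψ m ≤ C * fisherTestV n (sideLength ρ (n + 1)) Ψ m φ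

/-- **FG — Fisher-Gaussianity of the density mode** (registered as `stub_densityFisherGaussianity`,
the residual; size XL, believed sub-BEC strength): `∀ φ continuous, J_m(φ)·(N S_m) ≤ C`, i.e.
`I^V(Z_m) · E|Z_m|² ≤ C` (Cramér–Rao gives `≥ 4` when `E Z_m = 0`; `= 4` exactly for the free gas at
every `N` and for the Bogoliubov/Gaussian density mode). FS ⇒ FG (`fisherGaussianity_of_feynmanSaturation`).
Why it might fail: a Fisher-LOCAL-CLT at the anomalous scale `√(N S_k) ≍ N^{1/3}` (lowest mode, `d = 3`)
for DEPENDENT bounded phases under the interacting `Ψ²` — no tool in print; because `S` is UNCENTRED it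
fails for states with `|Z_m|` macroscopic (density waves, cluster crystals: excluded by `ρ < ρ₀` and
minimality). -/
def FisherGaussianityV : Prop :=
  CruxFrame fun C ρ n Ψ => ∀ m : Fin 3 → ℤ, m ≠ 0 → ∀ φ : ℂ → ℂ, Continuous φ →
    fisherTestV n (sideLength ρ (n + 1)) Ψ m φ *
      (((n : ℝ) + 1) * structureFactor n (sideLength ρ (n + 1)) Ψ m) ≤ C

/-- **DMD — density-moment domination** (fallback phase-side stub = the waypoint of the sibling card
`density-moment-domination`; WEAKER than FD: `densityMoment_of_fisherDomination`; necessary for IMU: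
`densityMoment_of_imu`): `4 N² ‖k‖⁴ ν_m ≤ C · m₂` (`ν_m ≤ (C/4)·(m₂/m₁)/‖k‖²/N`). Bogoliubov `C = 1`. -/
def DensityMomentDomination : Prop :=
  CruxFrame fun C ρ n Ψ => ∀ m : Fin 3 → ℤ, m ≠ 0 →
    4 * ((n : ℝ) + 1) ^ 2 * ‖waveVec (sideLength ρ (n + 1)) m‖ ^ 4 * levyWeight n (sideLength ρ (n + 1)) Ψ m ≤
      C * secondMoment (n + 1) (sideLength ρ (n + 1)) Ψ.ψ m

/-- **FS — Feynman single-mode saturation up to `C`** (fallback density-side residual, STRONGER than FG,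
weaker than SMB ∧ SFC): `(N S_m) · m₂ ≤ C · N² ‖k‖⁴`, i.e. `m₀ m₂ ≤ C m₁²` (Cauchy–Schwarz gives
`m₁² ≤ m₀ m₂`; Bogoliubov: equality, `C = 1`; `d = 1` Tonks: particle–hole continuum of width `O(k²)`,
bounded ratio). -/
def FeynmanSaturation : Prop :=
  CruxFrame fun C ρ n Ψ => ∀ m : Fin 3 → ℤ, m ≠ 0 →
    (((n : ℝ) + 1) * structureFactor n (sideLength ρ (n + 1)) Ψ m) *
        secondMoment (n + 1) (sideLength ρ (n + 1)) Ψ.ψ m ≤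
      C * (((n : ℝ) + 1) ^ 2 * ‖waveVec (sideLength ρ (n + 1)) m‖ ^ 4)

/-- **SMB — second-moment (Puff–Hölder) bound** (fallback, size L; shares its open input with the
route's crux `PuffFloor`): `m₂ ≤ C N ‖k‖³ √(‖k‖² + ρ)` (the scale `Θρ` of the card is absorbed into
`C`: `√(‖k‖²+Θρ) ≤ max(1,√Θ)√(‖k‖²+ρ)`). Intended proof: `m₂ = ⟨LZ, LZ⟩_μ ≤ √(m₁ M₃)`
(Cauchy–Schwarz for the Dirichlet form of `μ = Ψ²`, `L` the Langevin generator, needs `Ψ ∈ C³`),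
f-sum `m₁ = N‖k‖²`, Puff's cubic moment `M₃ ≤ N‖k‖⁴(‖k‖² + Θρ)` (double commutator + edge condition
+ the pair-count bound flagged on `PuffFloor`). Bogoliubov: `m₂ = N‖k‖³√(‖k‖²+16πρa)`. -/
def SecondMomentBound : Prop :=
  CruxFrame fun C ρ n Ψ => ∀ m : Fin 3 → ℤ, m ≠ 0 →
    secondMoment (n + 1) (sideLength ρ (n + 1)) Ψ.ψ m ≤
      C * ((n : ℝ) + 1) * ‖waveVec (sideLength ρ (n + 1)) m‖ ^ 3 *
        Real.sqrt (‖waveVec (sideLength ρ (n + 1)) m‖ ^ 2 + ρ)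

/-- **SFC — structure-factor ceiling** (fallback, size XL; density side, territory of the crux
`TorusHyperuniformity` of route `BECSectorPoincareTwoScale`): `S_m ≤ C‖k‖/√(‖k‖² + ρ)` ("`S` is not
larger than Feynman's", `S ≲ min(1, ‖k‖/√ρ)`; the card's `∀Θ'` form is equivalent, `Θ'` absorbed into
`C`). Via `m₀² ≤ m₁ m₋₁` it follows from a static-response bound `m₋₁ ≤ C² N/(‖k‖² + ρ)`, i.e. a
uniform-in-`N` second-order ENERGY LOWER BOUND for the gas in the weak density-wave potential
`λ(ρ_k + ρ_k†)` — the energy-method school's home turf. Bogoliubov: `S = ‖k‖/√(‖k‖²+16πρa)`. -/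
def StructureFactorCeiling : Prop :=
  CruxFrame fun C ρ n Ψ => ∀ m : Fin 3 → ℤ, m ≠ 0 →
    structureFactor n (sideLength ρ (n + 1)) Ψ m ≤
      C * ‖waveVec (sideLength ρ (n + 1)) m‖ / Real.sqrt (‖waveVec (sideLength ρ (n + 1)) m‖ ^ 2 + ρ)

/-! ## The lemma-exposing cut of FD (lead reshape r1): Stein identity, weak Euler–Lagrange,
coherence regularity, and the core phase stub in Stein form -/

/-- **SteinIdentity** (registered stub `stub_steinIdentity`; provable now, size M): for a real-valued
periodic `C¹` state, every mode `m` and every `C¹` field `φ`,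
`Re ∫ φ̄(Z_m) W_m Ψ̄ dX = ‖k‖² · Re ∫ (N ∂φ(Z_m) − ∂̄φ(Z_m) Z̄^{(2)}_m) |Ψ|² dX`
(periodic integration by parts along the density wave `Pi.single j k`, `∂_{xⱼ·k} e_m(x_l) = δ_{jl} i‖k‖² e_m`,
the real chain rule `D(φ∘Z)·h = ∂φ·(DZ·h) + ∂̄φ·conj(DZ·h)`, `∑ⱼ|eⱼ|² = N`, `∑ⱼ eⱼ² = Z^{(2)}`). With
`φ = id` it is the f-sum identity `FSumIdentity`. -/
def SteinIdentity : Prop :=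
  ∀ (n : ℕ) (L : ℝ), 0 < L → ∀ Ψ : PeriodicTrialState (n + 1) L, (∀ X, Ψ.ψ X = (‖Ψ.ψ X‖ : ℂ)) →
    ∀ (m : Fin 3 → ℤ) (φ : ℂ → ℂ), ContDiff ℝ 1 φ →
      (∫ X in cellN (n + 1) L, (starRingEnd ℂ (φ (∑ j : Fin (n + 1), cellWave L m (X j))) *
          (∑ j : Fin (n + 1), cellWave L m (X j) *
            (((‖((2 * Real.pi / L) • latticeVec 1 m)‖ ^ 2 : ℝ) : ℂ) * Ψ.ψ X -
              2 * Complex.I * fderiv ℝ Ψ.ψ X (Pi.single j ((2 * Real.pi / L) • latticeVec 1 m)))) *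
          starRingEnd ℂ (Ψ.ψ X)).re) =
        ‖((2 * Real.pi / L) • latticeVec 1 m)‖ ^ 2 *
          ∫ X in cellN (n + 1) L,
            ((((n : ℝ) + 1 : ℝ) : ℂ) *
                ((fderiv ℝ φ (∑ j : Fin (n + 1), cellWave L m (X j)) 1 -
                    Complex.I * fderiv ℝ φ (∑ j : Fin (n + 1), cellWave L m (X j)) Complex.I) / 2) -
              (fderiv ℝ φ (∑ j : Fin (n + 1), cellWave L m (X j)) 1 +
                    Complex.I * fderiv ℝ φ (∑ j : Fin (n + 1), cellWave L m (X j)) Complex.I) / 2 *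
                starRingEnd ℂ (∑ j : Fin (n + 1), cellWave L m (X j) ^ 2)).re * ‖Ψ.ψ X‖ ^ 2

/-- **WeakEulerLagrange** (registered stub `stub_weakEulerLagrange`; provable now, size L): a
finite-energy minimiser of the periodic `N`-body energy in the `C¹` periodic Bose class satisfies the
weak eigen-equation `Re q(η, Ψ) = E₀ · Re ⟨η, Ψ⟩` for every `C¹` periodic Bose-symmetric test function
`η` (`q` = the sesquilinear form of `H = −Δ + ∑_{i<j} v^per`, `E₀ = periodicGroundStateEnergy`): first
variation of the Rayleigh quotient along `Ψ + tη` (the variational principle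
`E₀‖Φ‖² ≤ Q(Φ)` for unnormalised `C¹` periodic symmetric `Φ`, equality at `Ψ`). The smooth-class
hypotheses on `v` make `v^per` bounded, so every pairing is a genuine Bochner integral. This is the
"first-gap resolution" input any proof of the crux must use (Disproof.lean §C). -/
def WeakEulerLagrange : Prop :=
  ∀ v : ℝ → ℝ≥0∞, IsRepulsiveFiniteRange v → (∀ r, v r ≠ ⊤) →
    ContDiff ℝ 2 (fun x : Space => (v ‖x‖).toReal) →
    (∃ Cₑ : ℝ, ∀ x : Space,
      ‖iteratedFDeriv ℝ 2 (fun x : Space => (v ‖x‖).toReal) x‖ ≤ Cₑ * Real.sqrt ((v ‖x‖).toReal)) →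
    ∀ (n : ℕ) (L : ℝ), 0 < L → ∀ Ψ : PeriodicTrialState (n + 1) L,
      periodicEnergy v Ψ = periodicGroundStateEnergy v (n + 1) L → periodicEnergy v Ψ ≠ ⊤ →
      ∀ η : Config (n + 1) → ℂ, ContDiff ℝ 1 η →
        (∀ (X : Config (n + 1)) (i : Fin (n + 1)) (k : Fin 3),
          η (X + Pi.single i (EuclideanSpace.single k L)) = η X) →
        (∀ (σ : Equiv.Perm (Fin (n + 1))) (X : Config (n + 1)), η (X ∘ σ) = η X) →
        (∫ X in cellN (n + 1) L,
            ((∑ i : Fin (n + 1), ∑ k : Fin 3,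
                (starRingEnd ℂ (fderiv ℝ η X (Pi.single i (EuclideanSpace.single k (1 : ℝ)))) *
                  fderiv ℝ Ψ.ψ X (Pi.single i (EuclideanSpace.single k (1 : ℝ)))).re) +
              (periodicInteraction v L X).toReal * (starRingEnd ℂ (η X) * Ψ.ψ X).re)) =
          (periodicGroundStateEnergy v (n + 1) L).toReal *
            ∫ X in cellN (n + 1) L, (starRingEnd ℂ (η X) * Ψ.ψ X).re

/-- **CoherenceRegular** (registered stub `stub_coherenceRegular`; provable now, size M): for a
pointwise non-vanishing periodic `C¹` state the translation-averaged coherence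
`g(r) = ∫_cell dx ∫_{cell^n} dY |Ψ(x+r,Y)||Ψ(x,Y)|` is continuous, strictly positive, `≤ 1`, `= 1` at
`r = 0`, even and `Lℤ³`-periodic (so `log g` is a genuine bounded continuous periodic function and
`ν_m = Re ĉ_m(log g)` a genuine Fourier coefficient). `g ≤ 1 = g(0)` are in the tree
(`Theorems.InfraredMinimumUncertainty.Negative.coherence_le_one/_zero`). -/
def CoherenceRegular : Prop :=
  ∀ (n : ℕ) (L : ℝ), 0 < L → ∀ Ψ : PeriodicTrialState (n + 1) L, (∀ X, Ψ.ψ X ≠ 0) →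
    Continuous (fun r : Space => ∫ x in cell L, ∫ Y in cellN n L,
        ‖Ψ.ψ (Matrix.vecCons (x + r) Y)‖ * ‖Ψ.ψ (Matrix.vecCons x Y)‖) ∧
    (∀ r : Space, 0 < ∫ x in cell L, ∫ Y in cellN n L,
        ‖Ψ.ψ (Matrix.vecCons (x + r) Y)‖ * ‖Ψ.ψ (Matrix.vecCons x Y)‖) ∧
    (∀ r : Space, (∫ x in cell L, ∫ Y in cellN n L,
        ‖Ψ.ψ (Matrix.vecCons (x + r) Y)‖ * ‖Ψ.ψ (Matrix.vecCons x Y)‖) ≤ 1) ∧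
    (∫ x in cell L, ∫ Y in cellN n L,
        ‖Ψ.ψ (Matrix.vecCons (x + 0) Y)‖ * ‖Ψ.ψ (Matrix.vecCons x Y)‖) = 1 ∧
    (∀ r : Space, (∫ x in cell L, ∫ Y in cellN n L,
        ‖Ψ.ψ (Matrix.vecCons (x + -r) Y)‖ * ‖Ψ.ψ (Matrix.vecCons x Y)‖) =
      ∫ x in cell L, ∫ Y in cellN n L,
        ‖Ψ.ψ (Matrix.vecCons (x + r) Y)‖ * ‖Ψ.ψ (Matrix.vecCons x Y)‖) ∧
    (∀ (r : Space) (k : Fin 3), (∫ x in cell L, ∫ Y in cellN n L,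
        ‖Ψ.ψ (Matrix.vecCons (x + (r + EuclideanSpace.single k L)) Y)‖ * ‖Ψ.ψ (Matrix.vecCons x Y)‖) =
      ∫ x in cell L, ∫ Y in cellN n L,
        ‖Ψ.ψ (Matrix.vecCons (x + r) Y)‖ * ‖Ψ.ψ (Matrix.vecCons x Y)‖)

/-- **PhaseSteinDomination** (registered stub `stub_phaseSteinDomination`, the lead's own, the CORE of
FD; open-problem strength): under the crux hypotheses PLUS the weak Euler–Lagrange identity of the
minimiser and the regularity of its coherence, for every `m ≠ 0` there is a `C¹` field `φ` with
`16 ν_m ≤ C · J^S_m(φ)`, `J^S` the Stein (derivative-free) form of the lifted Fisher functional. With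
`SteinIdentity` it gives `FisherDominationV` (`fisherDominationV_of_parts`). -/
def PhaseSteinDomination : Prop :=
  ∀ v : ℝ → ℝ≥0∞, IsRepulsiveFiniteRange v → (∀ r, v r ≠ ⊤) →
    ContDiff ℝ 2 (fun x : Space => (v ‖x‖).toReal) →
    (∃ Cₑ : ℝ, ∀ x : Space,
      ‖iteratedFDeriv ℝ 2 (fun x : Space => (v ‖x‖).toReal) x‖ ≤ Cₑ * Real.sqrt ((v ‖x‖).toReal)) →
    ∃ C : ℝ, 0 ≤ C ∧ ∃ ρ₀ : ℝ, 0 < ρ₀ ∧ ∀ ρ : ℝ, 0 < ρ → ρ < ρ₀ → ∀ᶠ n : ℕ in Filter.atTop,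
      ∀ Ψ : PeriodicTrialState (n + 1) (sideLength ρ (n + 1)),
        periodicEnergy v Ψ = periodicGroundStateEnergy v (n + 1) (sideLength ρ (n + 1)) →
        periodicEnergy v Ψ ≠ ⊤ → (∀ X, Ψ.ψ X = (‖Ψ.ψ X‖ : ℂ)) → (∀ X, Ψ.ψ X ≠ 0) →
        (∀ η : Config (n + 1) → ℂ, ContDiff ℝ 1 η →
          (∀ (X : Config (n + 1)) (i : Fin (n + 1)) (k : Fin 3),
            η (X + Pi.single i (EuclideanSpace.single k (sideLength ρ (n + 1)))) = η X) →
          (∀ (σ : Equiv.Perm (Fin (n + 1))) (X : Config (n + 1)), η (X ∘ σ) = η X) →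
          (∫ X in cellN (n + 1) (sideLength ρ (n + 1)),
              ((∑ i : Fin (n + 1), ∑ k : Fin 3,
                  (starRingEnd ℂ (fderiv ℝ η X (Pi.single i (EuclideanSpace.single k (1 : ℝ)))) *
                    fderiv ℝ Ψ.ψ X (Pi.single i (EuclideanSpace.single k (1 : ℝ)))).re) +
                (periodicInteraction v (sideLength ρ (n + 1)) X).toReal *
                  (starRingEnd ℂ (η X) * Ψ.ψ X).re)) =
            (periodicGroundStateEnergy v (n + 1) (sideLength ρ (n + 1))).toReal *
              ∫ X in cellN (n + 1) (sideLength ρ (n + 1)), (starRingEnd ℂ (η X) * Ψ.ψ X).re) →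
        Continuous (fun r : Space => ∫ x in cell (sideLength ρ (n + 1)), ∫ Y in cellN n (sideLength ρ (n + 1)),
            ‖Ψ.ψ (Matrix.vecCons (x + r) Y)‖ * ‖Ψ.ψ (Matrix.vecCons x Y)‖) →
        (∀ r : Space, 0 < ∫ x in cell (sideLength ρ (n + 1)), ∫ Y in cellN n (sideLength ρ (n + 1)),
            ‖Ψ.ψ (Matrix.vecCons (x + r) Y)‖ * ‖Ψ.ψ (Matrix.vecCons x Y)‖) →
        ∀ m : Fin 3 → ℤ, m ≠ 0 →
          ∃ φ : ℂ → ℂ, ContDiff ℝ 1 φ ∧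
            16 * (cellFourierCoeff (sideLength ρ (n + 1)) (fun r : Space => ((Real.log
              (∫ x in cell (sideLength ρ (n + 1)), ∫ Y in cellN n (sideLength ρ (n + 1)),
                ‖Ψ.ψ (Matrix.vecCons (x + r) Y)‖ * ‖Ψ.ψ (Matrix.vecCons x Y)‖) : ℝ) : ℂ)) m).re ≤
            C * (-(4 / ((n : ℝ) + 1)) *
                  (∫ X in cellN (n + 1) (sideLength ρ (n + 1)),
                    ((((n : ℝ) + 1 : ℝ) : ℂ) *
                        ((fderiv ℝ φ (∑ j : Fin (n + 1), cellWave (sideLength ρ (n + 1)) m (X j)) 1 -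
                            Complex.I * fderiv ℝ φ (∑ j : Fin (n + 1), cellWave (sideLength ρ (n + 1)) m (X j))
                              Complex.I) / 2) -
                      (fderiv ℝ φ (∑ j : Fin (n + 1), cellWave (sideLength ρ (n + 1)) m (X j)) 1 +
                            Complex.I * fderiv ℝ φ (∑ j : Fin (n + 1), cellWave (sideLength ρ (n + 1)) m (X j))
                              Complex.I) / 2 *
                        starRingEnd ℂ (∑ j : Fin (n + 1), cellWave (sideLength ρ (n + 1)) m (X j) ^ 2)).re *
                      ‖Ψ.ψ X‖ ^ 2) -
                ∫ X in cellN (n + 1) (sideLength ρ (n + 1)),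
                  ‖φ (∑ j : Fin (n + 1), cellWave (sideLength ρ (n + 1)) m (X j))‖ ^ 2 * ‖Ψ.ψ X‖ ^ 2)


/-! ## Registered stubs

Self-contained signatures over tree declarations only (under
`open Literature.MathematicalPhysics.QuantumManyBody.BoseGas`), fully substituted and LET-FREE (the
registry cuts a stub signature at its first `:=`, so no `let` may occur inside; `ν_m`, `S_m`, `k`, `Z_m`,
`W_m`, `J_m` appear expanded — read them through the named statements above, to which they are certified
equal by `fisherDominationV_iff_inline` / `fisherGaussianityV_iff_inline`, `Iff.rfl`). A stub worker
restates the signature verbatim in a `Theorems/` file. -/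

/-- **STUB (provable now, M) — `SteinIdentity`**: the Stein / by-parts form of the commutator pairing,
`Re ∫ φ̄(Z_m) W_m Ψ̄ = ‖k‖² Re ∫ (N ∂φ(Z_m) − ∂̄φ(Z_m) Z̄^{(2)}_m) |Ψ|²`, for real periodic `C¹` states and `C¹` fields. -/
theorem stub_steinIdentity :
    ∀ (n : ℕ) (L : ℝ), 0 < L → ∀ Ψ : PeriodicTrialState (n + 1) L, (∀ X, Ψ.ψ X = (‖Ψ.ψ X‖ : ℂ)) →
      ∀ (m : Fin 3 → ℤ) (φ : ℂ → ℂ), ContDiff ℝ 1 φ →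
        (∫ X in cellN (n + 1) L, (starRingEnd ℂ (φ (∑ j : Fin (n + 1), cellWave L m (X j))) *
            (∑ j : Fin (n + 1), cellWave L m (X j) *
              (((‖((2 * Real.pi / L) • latticeVec 1 m)‖ ^ 2 : ℝ) : ℂ) * Ψ.ψ X -
                2 * Complex.I * fderiv ℝ Ψ.ψ X (Pi.single j ((2 * Real.pi / L) • latticeVec 1 m)))) *
            starRingEnd ℂ (Ψ.ψ X)).re) =
          ‖((2 * Real.pi / L) • latticeVec 1 m)‖ ^ 2 *
            ∫ X in cellN (n + 1) L,
              ((((n : ℝ) + 1 : ℝ) : ℂ) *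
                  ((fderiv ℝ φ (∑ j : Fin (n + 1), cellWave L m (X j)) 1 -
                      Complex.I * fderiv ℝ φ (∑ j : Fin (n + 1), cellWave L m (X j)) Complex.I) / 2) -
                (fderiv ℝ φ (∑ j : Fin (n + 1), cellWave L m (X j)) 1 +
                      Complex.I * fderiv ℝ φ (∑ j : Fin (n + 1), cellWave L m (X j)) Complex.I) / 2 *
                  starRingEnd ℂ (∑ j : Fin (n + 1), cellWave L m (X j) ^ 2)).re * ‖Ψ.ψ X‖ ^ 2 := by
  sorry

/-- **STUB (provable now, L) — `WeakEulerLagrange`**: the weak eigen-equation `Re q(η, Ψ) = E₀ Re⟨η, Ψ⟩`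
of a finite-energy `C¹` periodic minimiser against `C¹` periodic Bose-symmetric test functions. -/
theorem stub_weakEulerLagrange :
    ∀ v : ℝ → ℝ≥0∞, IsRepulsiveFiniteRange v → (∀ r, v r ≠ ⊤) →
      ContDiff ℝ 2 (fun x : Space => (v ‖x‖).toReal) →
      (∃ Cₑ : ℝ, ∀ x : Space,
        ‖iteratedFDeriv ℝ 2 (fun x : Space => (v ‖x‖).toReal) x‖ ≤ Cₑ * Real.sqrt ((v ‖x‖).toReal)) →
      ∀ (n : ℕ) (L : ℝ), 0 < L → ∀ Ψ : PeriodicTrialState (n + 1) L,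
        periodicEnergy v Ψ = periodicGroundStateEnergy v (n + 1) L → periodicEnergy v Ψ ≠ ⊤ →
        ∀ η : Config (n + 1) → ℂ, ContDiff ℝ 1 η →
          (∀ (X : Config (n + 1)) (i : Fin (n + 1)) (k : Fin 3),
            η (X + Pi.single i (EuclideanSpace.single k L)) = η X) →
          (∀ (σ : Equiv.Perm (Fin (n + 1))) (X : Config (n + 1)), η (X ∘ σ) = η X) →
          (∫ X in cellN (n + 1) L,
              ((∑ i : Fin (n + 1), ∑ k : Fin 3,
                  (starRingEnd ℂ (fderiv ℝ η X (Pi.single i (EuclideanSpace.single k (1 : ℝ)))) *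
                    fderiv ℝ Ψ.ψ X (Pi.single i (EuclideanSpace.single k (1 : ℝ)))).re) +
                (periodicInteraction v L X).toReal * (starRingEnd ℂ (η X) * Ψ.ψ X).re)) =
            (periodicGroundStateEnergy v (n + 1) L).toReal *
              ∫ X in cellN (n + 1) L, (starRingEnd ℂ (η X) * Ψ.ψ X).re := by
  sorry

/-- **STUB (provable now, M) — `CoherenceRegular`**: continuity, strict positivity, `g ≤ 1 = g(0)`,
evenness and lattice periodicity of the coherence `g` of a non-vanishing periodic `C¹` state. -/
theorem stub_coherenceRegular :
    ∀ (n : ℕ) (L : ℝ), 0 < L → ∀ Ψ : PeriodicTrialState (n + 1) L, (∀ X, Ψ.ψ X ≠ 0) →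
      Continuous (fun r : Space => ∫ x in cell L, ∫ Y in cellN n L,
          ‖Ψ.ψ (Matrix.vecCons (x + r) Y)‖ * ‖Ψ.ψ (Matrix.vecCons x Y)‖) ∧
      (∀ r : Space, 0 < ∫ x in cell L, ∫ Y in cellN n L,
          ‖Ψ.ψ (Matrix.vecCons (x + r) Y)‖ * ‖Ψ.ψ (Matrix.vecCons x Y)‖) ∧
      (∀ r : Space, (∫ x in cell L, ∫ Y in cellN n L,
          ‖Ψ.ψ (Matrix.vecCons (x + r) Y)‖ * ‖Ψ.ψ (Matrix.vecCons x Y)‖) ≤ 1) ∧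
      (∫ x in cell L, ∫ Y in cellN n L,
          ‖Ψ.ψ (Matrix.vecCons (x + 0) Y)‖ * ‖Ψ.ψ (Matrix.vecCons x Y)‖) = 1 ∧
      (∀ r : Space, (∫ x in cell L, ∫ Y in cellN n L,
          ‖Ψ.ψ (Matrix.vecCons (x + -r) Y)‖ * ‖Ψ.ψ (Matrix.vecCons x Y)‖) =
        ∫ x in cell L, ∫ Y in cellN n L,
          ‖Ψ.ψ (Matrix.vecCons (x + r) Y)‖ * ‖Ψ.ψ (Matrix.vecCons x Y)‖) ∧
      (∀ (r : Space) (k : Fin 3), (∫ x in cell L, ∫ Y in cellN n L,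
          ‖Ψ.ψ (Matrix.vecCons (x + (r + EuclideanSpace.single k L)) Y)‖ * ‖Ψ.ψ (Matrix.vecCons x Y)‖) =
        ∫ x in cell L, ∫ Y in cellN n L,
          ‖Ψ.ψ (Matrix.vecCons (x + r) Y)‖ * ‖Ψ.ψ (Matrix.vecCons x Y)‖) := by
  sorry

/-- **STUB (the lead's; core of FD, open-problem strength) — `PhaseSteinDomination`**: under the crux
hypotheses plus the weak Euler–Lagrange identity and the regularity of `g`: `∃ φ ∈ C¹, 16 ν_m ≤ C · J^S_m(φ)`. -/
theorem stub_phaseSteinDomination :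
    ∀ v : ℝ → ℝ≥0∞, IsRepulsiveFiniteRange v → (∀ r, v r ≠ ⊤) →
      ContDiff ℝ 2 (fun x : Space => (v ‖x‖).toReal) →
      (∃ Cₑ : ℝ, ∀ x : Space,
        ‖iteratedFDeriv ℝ 2 (fun x : Space => (v ‖x‖).toReal) x‖ ≤ Cₑ * Real.sqrt ((v ‖x‖).toReal)) →
      ∃ C : ℝ, 0 ≤ C ∧ ∃ ρ₀ : ℝ, 0 < ρ₀ ∧ ∀ ρ : ℝ, 0 < ρ → ρ < ρ₀ → ∀ᶠ n : ℕ in Filter.atTop,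
        ∀ Ψ : PeriodicTrialState (n + 1) (sideLength ρ (n + 1)),
          periodicEnergy v Ψ = periodicGroundStateEnergy v (n + 1) (sideLength ρ (n + 1)) →
          periodicEnergy v Ψ ≠ ⊤ → (∀ X, Ψ.ψ X = (‖Ψ.ψ X‖ : ℂ)) → (∀ X, Ψ.ψ X ≠ 0) →
          (∀ η : Config (n + 1) → ℂ, ContDiff ℝ 1 η →
            (∀ (X : Config (n + 1)) (i : Fin (n + 1)) (k : Fin 3),
              η (X + Pi.single i (EuclideanSpace.single k (sideLength ρ (n + 1)))) = η X) →
            (∀ (σ : Equiv.Perm (Fin (n + 1))) (X : Config (n + 1)), η (X ∘ σ) = η X) →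
            (∫ X in cellN (n + 1) (sideLength ρ (n + 1)),
                ((∑ i : Fin (n + 1), ∑ k : Fin 3,
                    (starRingEnd ℂ (fderiv ℝ η X (Pi.single i (EuclideanSpace.single k (1 : ℝ)))) *
                      fderiv ℝ Ψ.ψ X (Pi.single i (EuclideanSpace.single k (1 : ℝ)))).re) +
                  (periodicInteraction v (sideLength ρ (n + 1)) X).toReal *
                    (starRingEnd ℂ (η X) * Ψ.ψ X).re)) =
              (periodicGroundStateEnergy v (n + 1) (sideLength ρ (n + 1))).toReal *
                ∫ X in cellN (n + 1) (sideLength ρ (n + 1)), (starRingEnd ℂ (η X) * Ψ.ψ X).re) →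
          Continuous (fun r : Space => ∫ x in cell (sideLength ρ (n + 1)), ∫ Y in cellN n (sideLength ρ (n + 1)),
              ‖Ψ.ψ (Matrix.vecCons (x + r) Y)‖ * ‖Ψ.ψ (Matrix.vecCons x Y)‖) →
          (∀ r : Space, 0 < ∫ x in cell (sideLength ρ (n + 1)), ∫ Y in cellN n (sideLength ρ (n + 1)),
              ‖Ψ.ψ (Matrix.vecCons (x + r) Y)‖ * ‖Ψ.ψ (Matrix.vecCons x Y)‖) →
          ∀ m : Fin 3 → ℤ, m ≠ 0 →
            ∃ φ : ℂ → ℂ, ContDiff ℝ 1 φ ∧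
              16 * (cellFourierCoeff (sideLength ρ (n + 1)) (fun r : Space => ((Real.log
                (∫ x in cell (sideLength ρ (n + 1)), ∫ Y in cellN n (sideLength ρ (n + 1)),
                  ‖Ψ.ψ (Matrix.vecCons (x + r) Y)‖ * ‖Ψ.ψ (Matrix.vecCons x Y)‖) : ℝ) : ℂ)) m).re ≤
              C * (-(4 / ((n : ℝ) + 1)) *
                    (∫ X in cellN (n + 1) (sideLength ρ (n + 1)),
                      ((((n : ℝ) + 1 : ℝ) : ℂ) *
                          ((fderiv ℝ φ (∑ j : Fin (n + 1), cellWave (sideLength ρ (n + 1)) m (X j)) 1 -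
                              Complex.I * fderiv ℝ φ (∑ j : Fin (n + 1), cellWave (sideLength ρ (n + 1)) m (X j))
                                Complex.I) / 2) -
                        (fderiv ℝ φ (∑ j : Fin (n + 1), cellWave (sideLength ρ (n + 1)) m (X j)) 1 +
                              Complex.I * fderiv ℝ φ (∑ j : Fin (n + 1), cellWave (sideLength ρ (n + 1)) m (X j))
                                Complex.I) / 2 *
                          starRingEnd ℂ (∑ j : Fin (n + 1), cellWave (sideLength ρ (n + 1)) m (X j) ^ 2)).re *
                        ‖Ψ.ψ X‖ ^ 2) -
                  ∫ X in cellN (n + 1) (sideLength ρ (n + 1)),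
                    ‖φ (∑ j : Fin (n + 1), cellWave (sideLength ρ (n + 1)) m (X j))‖ ^ 2 * ‖Ψ.ψ X‖ ^ 2) := by
  sorry

/-- **STUB 2 — `FisherGaussianityV`**: Fisher-Gaussianity of the density mode at its own scale:
`∀ φ continuous, J_m(φ) · (N S_m) ≤ C`. -/
theorem stub_densityFisherGaussianity :
    ∀ v : ℝ → ℝ≥0∞, IsRepulsiveFiniteRange v → (∀ r, v r ≠ ⊤) →
      ContDiff ℝ 2 (fun x : Space => (v ‖x‖).toReal) →
      (∃ Cₑ : ℝ, ∀ x : Space,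
        ‖iteratedFDeriv ℝ 2 (fun x : Space => (v ‖x‖).toReal) x‖ ≤ Cₑ * Real.sqrt ((v ‖x‖).toReal)) →
      ∃ C : ℝ, 0 ≤ C ∧ ∃ ρ₀ : ℝ, 0 < ρ₀ ∧ ∀ ρ : ℝ, 0 < ρ → ρ < ρ₀ → ∀ᶠ n : ℕ in Filter.atTop,
        ∀ Ψ : PeriodicTrialState (n + 1) (sideLength ρ (n + 1)),
          periodicEnergy v Ψ = periodicGroundStateEnergy v (n + 1) (sideLength ρ (n + 1)) →
          periodicEnergy v Ψ ≠ ⊤ → (∀ X, Ψ.ψ X = (‖Ψ.ψ X‖ : ℂ)) → (∀ X, Ψ.ψ X ≠ 0) →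
          ∀ m : Fin 3 → ℤ, m ≠ 0 →
            ∀ φ : ℂ → ℂ, Continuous φ →
              (-(4 / (((n : ℝ) + 1) * ‖((2 * Real.pi / sideLength ρ (n + 1)) • latticeVec 1 m)‖ ^ 2)) *
                (∫ X in cellN (n + 1) (sideLength ρ (n + 1)), (starRingEnd ℂ (φ (∑ j : Fin (n + 1), cellWave (sideLength ρ (n + 1)) m (X j))) *
                  (∑ j : Fin (n + 1), cellWave (sideLength ρ (n + 1)) m (X j) *
                (((‖((2 * Real.pi / sideLength ρ (n + 1)) • latticeVec 1 m)‖ ^ 2 : ℝ) : ℂ) * Ψ.ψ X -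
                  2 * Complex.I * fderiv ℝ Ψ.ψ X (Pi.single j ((2 * Real.pi / sideLength ρ (n + 1)) • latticeVec 1 m)))) * starRingEnd ℂ (Ψ.ψ X)).re) -
              ∫ X in cellN (n + 1) (sideLength ρ (n + 1)), ‖φ (∑ j : Fin (n + 1), cellWave (sideLength ρ (n + 1)) m (X j))‖ ^ 2 * ‖Ψ.ψ X‖ ^ 2) *
              (((n : ℝ) + 1) * (((n : ℝ) + 1)⁻¹ * ∫ X in cellN (n + 1) (sideLength ρ (n + 1)),
                ‖∑ j : Fin (n + 1), cellWave (sideLength ρ (n + 1)) m (X j)‖ ^ 2 * ‖Ψ.ψ X‖ ^ 2)) ≤ C := by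
  sorry

/-! ## The exact data-processing rung `J_m(φ) ≤ 4 m₂ / (N² ‖k‖⁴)` (proved) -/

section Analytic

theorem continuous_densityMode (N : ℕ) (L : ℝ) (m : Fin 3 → ℤ) :
    Continuous (densityMode N L m) := by
  unfold densityMode
  exact continuous_finsetSum _ fun j _ =>
    (contDiff_cellWave L m).continuous.comp (continuous_apply j)

theorem continuous_commutatorAmp (N : ℕ) (L : ℝ) {ψ : Config N → ℂ} (hψ : ContDiff ℝ 1 ψ)
    (m : Fin 3 → ℤ) : Continuous (commutatorAmp N L ψ m) := by
  unfold commutatorAmp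
  refine continuous_finsetSum _ fun j _ => ?_
  refine ((contDiff_cellWave L m).continuous.comp (continuous_apply j)).mul ?_
  refine (continuous_const.mul hψ.continuous).sub (continuous_const.mul ?_)
  exact (hψ.continuous_fderiv one_ne_zero).clm_apply continuous_const

/-- The pointwise inequality behind `J ≤ I_V`: `−2a Re(φ̄ W ψ̄) − |φ|²|ψ|² ≤ a²|W|²` for `a ≥ 0`
(`2(a|W|)(|φ||ψ|) ≤ (a|W|)² + (|φ||ψ|)²`). -/
theorem pointwise_amgm {a : ℝ} (ha : 0 ≤ a) (p W s : ℂ) :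
    -(2 * a) * (starRingEnd ℂ p * W * starRingEnd ℂ s).re - ‖p‖ ^ 2 * ‖s‖ ^ 2 ≤ a ^ 2 * ‖W‖ ^ 2 := by
  have hre : -((starRingEnd ℂ p * W * starRingEnd ℂ s).re) ≤ ‖p‖ * ‖W‖ * ‖s‖ := by
    have h1 := Complex.abs_re_le_norm (starRingEnd ℂ p * W * starRingEnd ℂ s)
    rw [norm_mul, norm_mul, Complex.norm_conj, Complex.norm_conj] at h1
    have := neg_abs_le ((starRingEnd ℂ p * W * starRingEnd ℂ s).re)
    linarith
  have h2 : 2 * (a * ‖W‖) * (‖p‖ * ‖s‖) ≤ (a * ‖W‖) ^ 2 + (‖p‖ * ‖s‖) ^ 2 := two_mul_le_add_sq _ _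
  have h3 : -(2 * a) * (starRingEnd ℂ p * W * starRingEnd ℂ s).re ≤ 2 * (a * ‖W‖) * (‖p‖ * ‖s‖) := by
    have := mul_le_mul_of_nonneg_left hre (by positivity : 0 ≤ 2 * a)
    nlinarith
  nlinarith [h2, h3]

/-- **`J_m(φ) ≤ 4m₂/(N²‖k‖⁴)` for every trial state, every mode and every continuous test field**
(the lifted Fisher information dominates its projection onto functions of the density mode; exact,
no Gram correction, no caustics). With FD this is FD(C) ⇒ DMD(C); with FS it is FS ⇒ FG. -/
theorem fisherTestV_le_secondMoment (n : ℕ) (L : ℝ) (Ψ : PeriodicTrialState (n + 1) L)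
    (m : Fin 3 → ℤ) {φ : ℂ → ℂ} (hφ : Continuous φ) :
    fisherTestV n L Ψ m φ ≤
      4 / (((n : ℝ) + 1) ^ 2 * ‖waveVec L m‖ ^ 4) * secondMoment (n + 1) L Ψ.ψ m := by
  set a : ℝ := 2 / (((n : ℝ) + 1) * ‖waveVec L m‖ ^ 2) with ha_def
  have ha : 0 ≤ a := by positivity
  have h4 : 4 / (((n : ℝ) + 1) * ‖waveVec L m‖ ^ 2) = 2 * a := by rw [ha_def]; ring
  have h4' : 4 / (((n : ℝ) + 1) ^ 2 * ‖waveVec L m‖ ^ 4) = a ^ 2 := by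
    rw [ha_def, div_pow]; ring
  have hZ := continuous_densityMode (n + 1) L m
  have hW := continuous_commutatorAmp (n + 1) L Ψ.contDiff m
  have hψ := Ψ.contDiff.continuous
  set f₁ : Config (n + 1) → ℝ := fun X =>
    (starRingEnd ℂ (φ (densityMode (n + 1) L m X)) * commutatorAmp (n + 1) L Ψ.ψ m X *
      starRingEnd ℂ (Ψ.ψ X)).re with hf₁
  set f₂ : Config (n + 1) → ℝ := fun X => ‖φ (densityMode (n + 1) L m X)‖ ^ 2 * ‖Ψ.ψ X‖ ^ 2 with hf₂
  set f₃ : Config (n + 1) → ℝ := fun X => ‖commutatorAmp (n + 1) L Ψ.ψ m X‖ ^ 2 with hf₃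
  have hc₁ : Continuous f₁ :=
    Complex.continuous_re.comp
      ((((Complex.continuous_conj.comp (hφ.comp hZ)).mul hW)).mul (Complex.continuous_conj.comp hψ))
  have hc₂ : Continuous f₂ := ((hφ.comp hZ).norm.pow 2).mul (hψ.norm.pow 2)
  have hc₃ : Continuous f₃ := hW.norm.pow 2
  have hi₁ : IntegrableOn f₁ (cellN (n + 1) L) volume := integrableOn_cellN hc₁ L
  have hi₂ : IntegrableOn f₂ (cellN (n + 1) L) volume := integrableOn_cellN hc₂ L
  have hi₃ : IntegrableOn f₃ (cellN (n + 1) L) volume := integrableOn_cellN hc₃ L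
  have hpt : ∀ X, -(2 * a) * f₁ X - f₂ X ≤ a ^ 2 * f₃ X := fun X => pointwise_amgm ha _ _ _
  have key : ∫ X in cellN (n + 1) L, (-(2 * a) * f₁ X - f₂ X) ≤ ∫ X in cellN (n + 1) L, a ^ 2 * f₃ X :=
    integral_mono ((hi₁.const_mul _).sub hi₂) (hi₃.const_mul _) hpt
  rw [integral_sub (hi₁.const_mul _) hi₂, integral_const_mul, integral_const_mul] at key
  unfold fisherTestV secondMoment
  rw [h4, h4']
  exact key

end Analytic

/-! ## The f-sum identity `Re ∫ Z̄ W Ψ̄ = N‖k‖²` (proved: periodic integration by parts)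

Calculus on the `N`-particle torus: the derivative of the plane waves along the density-wave direction
`Pi.single j k` (`∂_{x_j·k} e_m(x_l) = δ_{lj} i‖k‖² e_m(x_l)`), directional periodic integration by parts
(`integral_cellN_fderiv_single_eq_zero`, from `integral_cellN_pderiv_eq_zero` of `LangevinGenerator`),
the per-particle identity `∫ 2u ∂u · Im(Z̄eⱼ) = ‖k‖²∫u² − ‖k‖²∫u² Re(Z̄eⱼ)` (`fsum_stepB`), and the
assembly `fSumIdentity_holds`. -/

section FSum

variable {N : ℕ}

/-- coordinates of the wave vector -/
theorem waveVec_apply (L : ℝ) (m : Fin 3 → ℤ) (c : Fin 3) :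
    waveVec L m c = 2 * Real.pi / L * (m c : ℝ) := by
  simp [waveVec, latticeVec]

/-- `‖k‖² = ∑_c (k c)²` -/
theorem norm_sq_waveVec (L : ℝ) (m : Fin 3 → ℤ) :
    ‖waveVec L m‖ ^ 2 = ∑ c : Fin 3, (waveVec L m c) ^ 2 := by
  rw [EuclideanSpace.norm_eq, Real.sq_sqrt (Finset.sum_nonneg fun c _ => by positivity)]
  simp [Real.norm_eq_abs, sq_abs]

/-- the key arithmetic: `(2π i / L) · (∑_c m_c k_c) = i ‖k‖²` -/
theorem phase_factor_eq (L : ℝ) (m : Fin 3 → ℤ) :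
    (2 * Real.pi * Complex.I / L) * ((∑ c : Fin 3, (m c : ℝ) * waveVec L m c : ℝ) : ℂ) =
      Complex.I * ((‖waveVec L m‖ ^ 2 : ℝ) : ℂ) := by
  rw [norm_sq_waveVec]
  simp_rw [waveVec_apply]
  push_cast
  simp_rw [Finset.mul_sum]
  refine Finset.sum_congr rfl fun c _ => ?_
  ring

/-- derivative of `X ↦ e_m(X l)` in the direction `Pi.single j w` -/
theorem fderiv_cellWave_comp_apply (L : ℝ) (m : Fin 3 → ℤ) (l j : Fin N) (X : Config N) (w : Space) :
    fderiv ℝ (fun Y : Config N => cellWave L m (Y l)) X (Pi.single j w) =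
      if l = j then cellWave L m (X l) * ((2 * Real.pi * Complex.I / L) *
        ((∑ c : Fin 3, (m c : ℝ) * w c : ℝ) : ℂ)) else 0 := by
  have h₀ := (hasFDerivAt_cellWave L m (X l)).comp X (hasFDerivAt_apply (𝕜 := ℝ) l X)
  have h : HasFDerivAt (fun Y : Config N => cellWave L m (Y l))
      ((cellWave L m (X l) • ((2 * Real.pi * Complex.I / L) •
        (Complex.ofRealCLM.comp (∑ k : Fin 3, (m k : ℝ) • PiLp.proj (𝕜 := ℝ) 2 (fun _ : Fin 3 => ℝ) k)))).comp
        (ContinuousLinearMap.proj l)) X := h₀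
  rw [h.fderiv, ContinuousLinearMap.comp_apply, ContinuousLinearMap.proj_apply, Pi.single_apply]
  split_ifs with hlj
  · subst hlj
    rw [FunLike.coe_smul, FunLike.coe_smul, Pi.smul_apply, Pi.smul_apply, ← sum_coord_eq_clm]
    simp only [smul_eq_mul]
  · simp

/-- derivative of `X ↦ e_m(X l)` along the density-wave direction `Pi.single j k` is `δ_{lj} i‖k‖² e_m(X l)` -/
theorem fderiv_cellWave_comp_apply_waveVec (L : ℝ) (m : Fin 3 → ℤ) (l j : Fin N) (X : Config N) :
    fderiv ℝ (fun Y : Config N => cellWave L m (Y l)) X (Pi.single j (waveVec L m)) =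
      if l = j then Complex.I * ((‖waveVec L m‖ ^ 2 : ℝ) : ℂ) * cellWave L m (X l) else 0 := by
  rw [fderiv_cellWave_comp_apply]
  split_ifs
  · rw [phase_factor_eq]; ring
  · rfl

/-- `Pi.single j w = ∑_c w_c • Pi.single j e_c` -/
theorem pi_single_eq_sum (j : Fin N) (w : Space) :
    (Pi.single j w : Config N) = ∑ c : Fin 3, w c • (Pi.single j (EuclideanSpace.single c (1 : ℝ)) : Config N) := by
  have hw : w = ∑ c : Fin 3, w c • EuclideanSpace.single c (1 : ℝ) := by
    conv_lhs => rw [← (EuclideanSpace.basisFun (Fin 3) ℝ).sum_repr w]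
    simp [EuclideanSpace.basisFun_apply]
  funext i
  rw [Finset.sum_apply]
  by_cases hij : i = j
  · subst hij
    simp only [Pi.single_eq_same, Pi.smul_apply]
    exact hw
  · simp [Pi.single_eq_of_ne hij]

/-- **directional periodic integration by parts**: `∫_{cell^N} ∂_{x_j · w} G = 0` -/
theorem integral_cellN_fderiv_single_eq_zero {L : ℝ} (hL : 0 < L) {G : Config N → ℝ}
    (hG : ContDiff ℝ 1 G) (hper : IsLatticePeriodic L G) (j : Fin N) (w : Space) :
    ∫ X in cellN N L, fderiv ℝ G X (Pi.single j w) = 0 := by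
  have hlin : ∀ X, fderiv ℝ G X (Pi.single j w) = ∑ c : Fin 3, w c * pderiv j c G X := by
    intro X
    rw [pi_single_eq_sum, map_sum]
    refine Finset.sum_congr rfl fun c _ => ?_
    rw [map_smul, smul_eq_mul, pderiv]
  simp_rw [hlin]
  rw [integral_finsetSum _ fun c _ => ((integrableOn_cellN (continuous_pderiv hG j c) L).const_mul _)]
  refine Finset.sum_eq_zero fun c _ => ?_
  rw [integral_const_mul, integral_cellN_pderiv_eq_zero hL hG hper j c, mul_zero]


theorem differentiableAt_cellWave_comp_apply (L : ℝ) (m : Fin 3 → ℤ) (l : Fin N) (X : Config N) :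
    DifferentiableAt ℝ (fun Y : Config N => cellWave L m (Y l)) X := by
  have h₀ := (hasFDerivAt_cellWave L m (X l)).comp X (hasFDerivAt_apply (𝕜 := ℝ) l X)
  exact h₀.differentiableAt

theorem contDiff_cellWave_comp_apply (L : ℝ) (m : Fin 3 → ℤ) (l : Fin N) :
    ContDiff ℝ 1 (fun Y : Config N => cellWave L m (Y l)) :=
  ((contDiff_cellWave L m).of_le (by exact_mod_cast le_top)).comp (contDiff_apply ℝ Space l)

/-- `∂_{x_j·k} Z = i‖k‖² e_j` -/
theorem fderiv_densityMode_waveVec (L : ℝ) (m : Fin 3 → ℤ) (j : Fin N) (X : Config N) :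
    fderiv ℝ (densityMode N L m) X (Pi.single j (waveVec L m)) =
      Complex.I * ((‖waveVec L m‖ ^ 2 : ℝ) : ℂ) * cellWave L m (X j) := by
  have h₀ := HasFDerivAt.fun_sum (u := Finset.univ)
      (fun l _ => (differentiableAt_cellWave_comp_apply L m l X).hasFDerivAt)
  have h : HasFDerivAt (densityMode N L m)
      (∑ l : Fin N, fderiv ℝ (fun Y : Config N => cellWave L m (Y l)) X) X := h₀
  rw [h.fderiv, FunLike.coe_sum, Finset.sum_apply]
  simp_rw [fderiv_cellWave_comp_apply_waveVec]
  simp [Finset.sum_ite_eq']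

theorem contDiff_densityMode (N : ℕ) (L : ℝ) (m : Fin 3 → ℤ) :
    ContDiff ℝ 1 (densityMode N L m) := by
  unfold densityMode
  exact ContDiff.sum fun l _ => contDiff_cellWave_comp_apply L m l

/-- the phase factor `F_j = Im(Z̄ e_j)` and its derivative along the density wave:
`∂_{x_j·k} Im(Z̄ e_j) = ‖k‖² Re(Z̄ e_j) − ‖k‖²` -/
theorem fderiv_phaseIm_waveVec (L : ℝ) (m : Fin 3 → ℤ) (j : Fin N) (X : Config N) :
    fderiv ℝ (fun Y : Config N => (starRingEnd ℂ (densityMode N L m Y) * cellWave L m (Y j)).im) X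
        (Pi.single j (waveVec L m)) =
      ‖waveVec L m‖ ^ 2 * (starRingEnd ℂ (densityMode N L m X) * cellWave L m (X j)).re -
        ‖waveVec L m‖ ^ 2 := by
  have hZ : HasFDerivAt (densityMode N L m) (fderiv ℝ (densityMode N L m) X) X :=
    ((contDiff_densityMode N L m).differentiable one_ne_zero X).hasFDerivAt
  have hZc : HasFDerivAt (fun Y => star (densityMode N L m Y))
      (((starL' ℝ : ℂ ≃L[ℝ] ℂ) : ℂ →L[ℝ] ℂ).comp (fderiv ℝ (densityMode N L m) X)) X := hZ.star
  have he : HasFDerivAt (fun Y : Config N => cellWave L m (Y j))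
      (fderiv ℝ (fun Y : Config N => cellWave L m (Y j)) X) X :=
    (differentiableAt_cellWave_comp_apply L m j X).hasFDerivAt
  have hprod := hZc.mul he
  have hF := (Complex.imCLM.hasFDerivAt.comp X hprod)
  have hF' : HasFDerivAt (fun Y : Config N => (starRingEnd ℂ (densityMode N L m Y) * cellWave L m (Y j)).im)
      (Complex.imCLM.comp (star (densityMode N L m X) • fderiv ℝ (fun Y : Config N => cellWave L m (Y j)) X +
        cellWave L m (X j) • ((starL' ℝ : ℂ ≃L[ℝ] ℂ) : ℂ →L[ℝ] ℂ).comp (fderiv ℝ (densityMode N L m) X))) X :=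
    hF
  rw [hF'.fderiv]
  simp only [ContinuousLinearMap.comp_apply, FunLike.coe_add, Pi.add_apply,
    FunLike.coe_smul, Pi.smul_apply, ContinuousLinearEquiv.coe_coe, starL'_apply,
    Complex.star_def, smul_eq_mul, Complex.imCLM_apply]
  rw [fderiv_cellWave_comp_apply_waveVec, fderiv_densityMode_waveVec, if_pos rfl]
  have ht : cellWave L m (X j) * starRingEnd ℂ (cellWave L m (X j)) = 1 := by
    rw [mul_comm, ← Complex.normSq_eq_conj_mul_self, Complex.normSq_eq_norm_sq, norm_cellWave]
    simp
  have key : starRingEnd ℂ (densityMode N L m X) *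
        (Complex.I * ((‖waveVec L m‖ ^ 2 : ℝ) : ℂ) * cellWave L m (X j)) +
      cellWave L m (X j) * starRingEnd ℂ (Complex.I * ((‖waveVec L m‖ ^ 2 : ℝ) : ℂ) * cellWave L m (X j)) =
      Complex.I * ((‖waveVec L m‖ ^ 2 : ℝ) : ℂ) * (starRingEnd ℂ (densityMode N L m X) * cellWave L m (X j)) -
        Complex.I * ((‖waveVec L m‖ ^ 2 : ℝ) : ℂ) := by
    rw [map_mul, map_mul, Complex.conj_I, Complex.conj_ofReal]
    linear_combination (-(Complex.I * ((‖waveVec L m‖ ^ 2 : ℝ) : ℂ))) * ht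
  rw [key]
  set κ : ℝ := ‖waveVec L m‖ ^ 2 with hκ
  simp only [Complex.sub_im, Complex.mul_im, Complex.mul_re, Complex.I_re, Complex.I_im,
    Complex.ofReal_re, Complex.ofReal_im, zero_mul, one_mul, mul_zero, sub_zero, zero_add]


/-! ### periodicity helpers -/

theorem cellWave_comp_apply_periodic {L : ℝ} (hL : L ≠ 0) (m : Fin 3 → ℤ) (l : Fin N) (X : Config N)
    (i : Fin N) (c : Fin 3) :
    cellWave L m ((X + Pi.single i (EuclideanSpace.single c L) : Config N) l) = cellWave L m (X l) := by
  rw [Pi.add_apply]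
  by_cases hli : l = i
  · subst hli
    rw [Pi.single_eq_same, cellWave_periodic hL]
  · rw [Pi.single_eq_of_ne hli, add_zero]

theorem densityMode_periodic {L : ℝ} (hL : L ≠ 0) (m : Fin 3 → ℤ) (X : Config N) (i : Fin N) (c : Fin 3) :
    densityMode N L m (X + Pi.single i (EuclideanSpace.single c L)) = densityMode N L m X := by
  unfold densityMode
  exact Finset.sum_congr rfl fun l _ => cellWave_comp_apply_periodic hL m l X i c

/-! ### Step B -/

theorem contDiff_phaseIm (L : ℝ) (m : Fin 3 → ℤ) (j : Fin N) :
    ContDiff ℝ 1 (fun Y : Config N => (starRingEnd ℂ (densityMode N L m Y) * cellWave L m (Y j)).im) := by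
  have h₀ := Complex.imCLM.contDiff.comp
    ((Complex.conjCLE.contDiff.comp (contDiff_densityMode N L m)).mul (contDiff_cellWave_comp_apply L m j))
  exact h₀

/-- complex algebra of one summand of `Re(Z̄ W ū)` for a real amplitude -/
theorem re_summand (w : ℂ) (κ u u' : ℝ) :
    (w * (((κ : ℝ) : ℂ) * ((u : ℝ) : ℂ) - 2 * Complex.I * ((u' : ℝ) : ℂ)) * ((u : ℝ) : ℂ)).re =
      κ * u ^ 2 * w.re + 2 * u * u' * w.im := by
  simp only [Complex.mul_re, Complex.mul_im, Complex.sub_re, Complex.sub_im, Complex.ofReal_re,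
    Complex.ofReal_im, Complex.I_re, Complex.I_im, Complex.re_ofNat, Complex.im_ofNat]
  ring

/-- **Step B** (per particle, periodic integration by parts along the density wave):
`∫ 2 u ∂_{x_j·k}u · Im(Z̄ e_j) = ‖k‖² ∫ u² − ‖k‖² ∫ u² Re(Z̄ e_j)` for a real `C¹` lattice-periodic `u`. -/
theorem fsum_stepB {L : ℝ} (hL : 0 < L) (m : Fin 3 → ℤ) {u : Config N → ℝ} (hu : ContDiff ℝ 1 u)
    (hper : IsLatticePeriodic L u) (j : Fin N) :
    ∫ X in cellN N L, 2 * u X * fderiv ℝ u X (Pi.single j (waveVec L m)) *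
        (starRingEnd ℂ (densityMode N L m X) * cellWave L m (X j)).im =
      (‖waveVec L m‖ ^ 2 * ∫ X in cellN N L, u X ^ 2) -
        ‖waveVec L m‖ ^ 2 * ∫ X in cellN N L,
          u X ^ 2 * (starRingEnd ℂ (densityMode N L m X) * cellWave L m (X j)).re := by
  set κ : ℝ := ‖waveVec L m‖ ^ 2 with hκ
  set d : Config N := Pi.single j (waveVec L m) with hd
  set F : Config N → ℝ := fun Y => (starRingEnd ℂ (densityMode N L m Y) * cellWave L m (Y j)).im with hFdef
  set R : Config N → ℝ := fun Y => (starRingEnd ℂ (densityMode N L m Y) * cellWave L m (Y j)).re with hRdef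
  have hF_cd : ContDiff ℝ 1 F := contDiff_phaseIm L m j
  have hu_d : Differentiable ℝ u := hu.differentiable one_ne_zero
  -- the flux `G = u² F` is `C¹` and lattice periodic
  set G : Config N → ℝ := fun Y => u Y * u Y * F Y with hGdef
  have hG_cd : ContDiff ℝ 1 G := (hu.mul hu).mul hF_cd
  have hG_per : IsLatticePeriodic L G := by
    intro Y i c
    simp only [hGdef, hFdef, hper Y i c, densityMode_periodic hL.ne' m Y i c]
    rw [cellWave_comp_apply_periodic hL.ne' m j Y i c]
  -- its directional derivative
  have hderiv : ∀ X, fderiv ℝ G X d = u X ^ 2 * (κ * R X - κ) + 2 * u X * fderiv ℝ u X d * F X := by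
    intro X
    have hu' : HasFDerivAt u (fderiv ℝ u X) X := (hu_d X).hasFDerivAt
    have hF' : HasFDerivAt F (fderiv ℝ F X) X := (hF_cd.differentiable one_ne_zero X).hasFDerivAt
    have hG' : HasFDerivAt G _ X := (hu'.mul hu').mul hF'
    rw [hG'.fderiv]
    simp only [FunLike.coe_add, Pi.add_apply, FunLike.coe_smul, Pi.smul_apply,
      smul_eq_mul, Pi.mul_apply]
    rw [show fderiv ℝ F X d = κ * R X - κ from fderiv_phaseIm_waveVec L m j X]
    ring
  -- by parts
  have hbp : ∫ X in cellN N L, fderiv ℝ G X d = 0 :=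
    integral_cellN_fderiv_single_eq_zero hL hG_cd hG_per j (waveVec L m)
  simp_rw [hderiv] at hbp
  -- integrability of the pieces
  have hZc := continuous_densityMode N L m
  have hec : Continuous (fun Y : Config N => cellWave L m (Y j)) :=
    (contDiff_cellWave L m).continuous.comp (continuous_apply j)
  have hRc : Continuous R :=
    Complex.continuous_re.comp ((Complex.continuous_conj.comp hZc).mul hec)
  have hFc : Continuous F :=
    Complex.continuous_im.comp ((Complex.continuous_conj.comp hZc).mul hec)
  have huc : Continuous u := hu.continuous
  have hu'c : Continuous (fun Y => fderiv ℝ u Y d) := (hu.continuous_fderiv one_ne_zero).clm_apply continuous_const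
  have hi1 : IntegrableOn (fun X => u X ^ 2 * (κ * R X - κ)) (cellN N L) volume :=
    integrableOn_cellN ((huc.pow 2).mul ((continuous_const.mul hRc).sub continuous_const)) L
  have hi2 : IntegrableOn (fun X => 2 * u X * fderiv ℝ u X d * F X) (cellN N L) volume :=
    integrableOn_cellN (((continuous_const.mul huc).mul hu'c).mul hFc) L
  have hi3 : IntegrableOn (fun X => u X ^ 2) (cellN N L) volume := integrableOn_cellN (huc.pow 2) L
  have hi4 : IntegrableOn (fun X => u X ^ 2 * R X) (cellN N L) volume :=
    integrableOn_cellN ((huc.pow 2).mul hRc) L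
  rw [integral_add hi1 hi2] at hbp
  have h1 : ∫ X in cellN N L, u X ^ 2 * (κ * R X - κ) =
      (κ * ∫ X in cellN N L, u X ^ 2 * R X) - κ * ∫ X in cellN N L, u X ^ 2 := by
    have : ∀ X, u X ^ 2 * (κ * R X - κ) = κ * (u X ^ 2 * R X) - κ * u X ^ 2 := fun X => by ring
    simp_rw [this]
    rw [integral_sub (hi4.const_mul κ) (hi3.const_mul κ), integral_const_mul, integral_const_mul]
  rw [h1] at hbp
  linarith


/-! ### Assembly: the f-sum identity -/

/-- The Bochner normalisation of an admissible state: `∫_{cell^N} |Ψ|² = 1`. -/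
theorem integral_norm_sq_eq_one {N : ℕ} {L : ℝ} (Ψ : PeriodicTrialState N L) :
    ∫ X in cellN N L, ‖Ψ.ψ X‖ ^ 2 = 1 := by
  have hint : Integrable (fun X => ‖Ψ.ψ X‖ ^ 2) (volume.restrict (cellN N L)) :=
    integrableOn_cellN ((Ψ.contDiff.continuous.norm).pow 2) L
  have h := ofReal_integral_eq_lintegral_ofReal hint
    (Filter.Eventually.of_forall fun X => sq_nonneg _)
  simp_rw [← coe_nnnorm_sq_eq_ofReal] at h
  rw [Ψ.norm_eq] at h
  have hnn : 0 ≤ ∫ X in cellN N L, ‖Ψ.ψ X‖ ^ 2 := integral_nonneg fun X => sq_nonneg _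
  have := congrArg ENNReal.toReal h
  rwa [ENNReal.toReal_ofReal hnn, ENNReal.toReal_one] at this

/-- **The f-sum identity** `Re ∫ Z̄_m W_m Ψ̄ = N ‖k‖²` for a real-valued normalised periodic `C¹` state. -/
theorem fSumIdentity_holds (n : ℕ) (L : ℝ) (hL : 0 < L) (Ψ : PeriodicTrialState (n + 1) L)
    (hreal : ∀ X, Ψ.ψ X = (‖Ψ.ψ X‖ : ℂ)) (m : Fin 3 → ℤ) :
    (∫ X in cellN (n + 1) L, (starRingEnd ℂ (densityMode (n + 1) L m X) *
        commutatorAmp (n + 1) L Ψ.ψ m X * starRingEnd ℂ (Ψ.ψ X)).re) =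
      ((n : ℝ) + 1) * ‖waveVec L m‖ ^ 2 := by
  -- the real amplitude `u = Re Ψ = |Ψ|`
  set u : Config (n + 1) → ℝ := fun X => (Ψ.ψ X).re with hudef
  have hψu : ∀ X, Ψ.ψ X = ((u X : ℝ) : ℂ) := fun X => by
    calc Ψ.ψ X = ((‖Ψ.ψ X‖ : ℝ) : ℂ) := hreal X
      _ = ((((‖Ψ.ψ X‖ : ℝ) : ℂ).re : ℝ) : ℂ) := by rw [Complex.ofReal_re]
      _ = ((u X : ℝ) : ℂ) := by rw [← hreal X]
  have hu_cd : ContDiff ℝ 1 u := by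
    have h₀ := Complex.reCLM.contDiff.comp Ψ.contDiff
    exact h₀
  have hu_per : IsLatticePeriodic L u := fun X i c => by
    show (Ψ.ψ (X + Pi.single i (EuclideanSpace.single c L))).re = (Ψ.ψ X).re
    rw [Ψ.periodic X i c]
  have hfun : Ψ.ψ = fun X => ((u X : ℝ) : ℂ) := funext hψu
  have hderiv : ∀ X (v : Config (n + 1)), fderiv ℝ Ψ.ψ X v = ((fderiv ℝ u X v : ℝ) : ℂ) := by
    intro X v
    have h₁ := Complex.ofRealCLM.hasFDerivAt.comp X ((hu_cd.differentiable one_ne_zero) X).hasFDerivAt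
    have h₂ : HasFDerivAt Ψ.ψ (Complex.ofRealCLM.comp (fderiv ℝ u X)) X := by
      rw [hfun]; exact h₁
    rw [h₂.fderiv, ContinuousLinearMap.comp_apply, Complex.ofRealCLM_apply]
  set κ : ℝ := ‖waveVec L m‖ ^ 2 with hκ
  -- pointwise expansion of the integrand
  set R : Fin (n + 1) → Config (n + 1) → ℝ := fun j X =>
    (starRingEnd ℂ (densityMode (n + 1) L m X) * cellWave L m (X j)).re with hRdef
  set F : Fin (n + 1) → Config (n + 1) → ℝ := fun j X =>
    (starRingEnd ℂ (densityMode (n + 1) L m X) * cellWave L m (X j)).im with hFdef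
  set du : Fin (n + 1) → Config (n + 1) → ℝ := fun j X =>
    fderiv ℝ u X (Pi.single j (waveVec L m)) with hdudef
  have hpt : ∀ X, (starRingEnd ℂ (densityMode (n + 1) L m X) *
      commutatorAmp (n + 1) L Ψ.ψ m X * starRingEnd ℂ (Ψ.ψ X)).re =
      ∑ j : Fin (n + 1), (κ * (u X ^ 2 * R j X) + 2 * u X * du j X * F j X) := by
    intro X
    have hW : commutatorAmp (n + 1) L Ψ.ψ m X = ∑ j : Fin (n + 1), cellWave L m (X j) *
        (((κ : ℝ) : ℂ) * ((u X : ℝ) : ℂ) - 2 * Complex.I * ((du j X : ℝ) : ℂ)) := by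
      unfold commutatorAmp
      refine Finset.sum_congr rfl fun j _ => ?_
      rw [hderiv, ← hψu X]
    rw [hW, Finset.mul_sum, Finset.sum_mul, Complex.re_sum]
    refine Finset.sum_congr rfl fun j _ => ?_
    rw [hψu X, Complex.conj_ofReal]
    have := re_summand (starRingEnd ℂ (densityMode (n + 1) L m X) * cellWave L m (X j)) κ (u X) (du j X)
    rw [show starRingEnd ℂ (densityMode (n + 1) L m X) *
        (cellWave L m (X j) * (((κ : ℝ) : ℂ) * ((u X : ℝ) : ℂ) - 2 * Complex.I * ((du j X : ℝ) : ℂ))) *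
        ((u X : ℝ) : ℂ) =
      starRingEnd ℂ (densityMode (n + 1) L m X) * cellWave L m (X j) *
        (((κ : ℝ) : ℂ) * ((u X : ℝ) : ℂ) - 2 * Complex.I * ((du j X : ℝ) : ℂ)) * ((u X : ℝ) : ℂ) by ring]
    rw [this]
    ring
  simp_rw [hpt]
  -- integrability and Step B per particle
  have hZc := continuous_densityMode (n + 1) L m
  have hec : ∀ j : Fin (n + 1), Continuous (fun Y : Config (n + 1) => cellWave L m (Y j)) := fun j =>
    (contDiff_cellWave L m).continuous.comp (continuous_apply j)
  have hRc : ∀ j, Continuous (R j) := fun j =>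
    Complex.continuous_re.comp ((Complex.continuous_conj.comp hZc).mul (hec j))
  have hFc : ∀ j, Continuous (F j) := fun j =>
    Complex.continuous_im.comp ((Complex.continuous_conj.comp hZc).mul (hec j))
  have huc : Continuous u := hu_cd.continuous
  have hduc : ∀ j, Continuous (du j) := fun j =>
    (hu_cd.continuous_fderiv one_ne_zero).clm_apply continuous_const
  have hiA : ∀ j, IntegrableOn (fun X => κ * (u X ^ 2 * R j X)) (cellN (n + 1) L) volume := fun j =>
    integrableOn_cellN (continuous_const.mul ((huc.pow 2).mul (hRc j))) L
  have hiB : ∀ j, IntegrableOn (fun X => 2 * u X * du j X * F j X) (cellN (n + 1) L) volume := fun j =>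
    integrableOn_cellN (((continuous_const.mul huc).mul (hduc j)).mul (hFc j)) L
  have hiAB : ∀ j : Fin (n + 1),
      Integrable (fun X => κ * (u X ^ 2 * R j X) + 2 * u X * du j X * F j X)
        (volume.restrict (cellN (n + 1) L)) := fun j => (hiA j).add (hiB j)
  rw [integral_finsetSum _ fun j _ => hiAB j]
  have hstep : ∀ j : Fin (n + 1), ∫ X in cellN (n + 1) L, (κ * (u X ^ 2 * R j X) + 2 * u X * du j X * F j X) =
      κ * ∫ X in cellN (n + 1) L, u X ^ 2 := by
    intro j
    rw [integral_add (hiA j) (hiB j), integral_const_mul]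
    have hB := fsum_stepB hL m hu_cd hu_per j
    simp only [hdudef, hFdef, hRdef] at hB ⊢
    rw [hB]
    ring
  simp_rw [hstep]
  rw [Finset.sum_const, Finset.card_univ, Fintype.card_fin, nsmul_eq_mul]
  -- `∫ u² = 1`
  have hnorm : ∫ X in cellN (n + 1) L, u X ^ 2 = 1 := by
    have h1 := integral_norm_sq_eq_one Ψ
    have : ∀ X, ‖Ψ.ψ X‖ ^ 2 = u X ^ 2 := fun X => by
      rw [hψu X, Complex.norm_real, Real.norm_eq_abs, sq_abs]
    simp_rw [this] at h1
    exact h1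
  rw [hnorm]
  push_cast
  ring


end FSum

/-! ## Positivity helpers -/

section Helpers

/-- `L = (N/ρ)^{1/3} > 0`. -/
theorem sideLength_succ_pos {ρ : ℝ} (hρ : 0 < ρ) (n : ℕ) : 0 < sideLength ρ (n + 1) := by
  unfold sideLength
  apply Real.rpow_pos_of_pos
  push_cast
  positivity

theorem latticeVec_one_ne_zero {m : Fin 3 → ℤ} (hm : m ≠ 0) : latticeVec 1 m ≠ 0 := by
  intro h
  apply hm
  funext k
  have := congrArg (fun v : Space => v k) h
  simpa [latticeVec] using this

theorem norm_waveVec_pos {L : ℝ} (hL : 0 < L) {m : Fin 3 → ℤ} (hm : m ≠ 0) :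
    0 < ‖waveVec L m‖ := by
  unfold waveVec
  rw [norm_smul]
  exact mul_pos (by rw [Real.norm_eq_abs, abs_of_pos (by positivity)]; positivity)
    (norm_pos_iff.mpr (latticeVec_one_ne_zero hm))

theorem secondMoment_nonneg (N : ℕ) (L : ℝ) (ψ : Config N → ℂ) (m : Fin 3 → ℤ) :
    0 ≤ secondMoment N L ψ m :=
  integral_nonneg fun X => by positivity

theorem mul_structureFactor_nonneg (n : ℕ) (L : ℝ) (Ψ : PeriodicTrialState (n + 1) L)
    (m : Fin 3 → ℤ) : 0 ≤ ((n : ℝ) + 1) * structureFactor n L Ψ m := by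
  unfold structureFactor
  have hI : 0 ≤ ∫ X in cellN (n + 1) L, ‖∑ j : Fin (n + 1), cellWave L m (X j)‖ ^ 2 * ‖Ψ.ψ X‖ ^ 2 :=
    integral_nonneg fun X => by positivity
  positivity


end Helpers

/-! ## Compositions (all sorry-free)

The registered cut: FD ∧ FG ⇒ IMU.  The fallback cuts: DMD ∧ FS ⇒ IMU, SMB ∧ SFC ⇒ FS, FS ⇒ FG, FD ⇒ DMD.
The glue lemmas conclude the crux RESTATED OVER THE NAMED OBJECTS (`InfraredMinimumUncertaintyNamed`,
certified equal to the route decl by `infraredMinimumUncertainty_iff_named : … ↔ … := Iff.rfl`), so that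
exactly ONE theorem of this file — `InfraredMinimumUncertainty_of` — concludes the route decl by name
(the skeleton audit takes the first such theorem as the skeleton). -/

section Compositions

/-- **The crux, restated over the named objects**: `CruxFrame (Π_m = N·ν_m·S_m ≤ C)`. Definitionally equal
to `Theses.BECConjugateDomination.InfraredMinimumUncertainty` (its `let`s `L, g, ν, S` zeta-reduce to the
bodies of `sideLength`, `coherence`, `levyWeight`, `structureFactor`). -/
def InfraredMinimumUncertaintyNamed : Prop :=
  CruxFrame fun C ρ n Ψ => ∀ m : Fin 3 → ℤ, m ≠ 0 →
    ((n : ℝ) + 1) * levyWeight n (sideLength ρ (n + 1)) Ψ m *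
      structureFactor n (sideLength ρ (n + 1)) Ψ m ≤ C

/-- Certificate: the named restatement IS the crux (by `Iff.rfl`). -/
theorem infraredMinimumUncertainty_iff_named :
    InfraredMinimumUncertaintyNamed ↔ InfraredMinimumUncertainty :=
  Iff.rfl

/-- **FD ∧ FG ⇒ IMU, constants tracked**: `16 ν (N S) ≤ C₁ J(φ) (N S) ≤ C₁ C₂`, so the crux holds with
`C = C₁ C₂ / 16` and `ρ₀ = min ρ₁ ρ₂`. -/
theorem imu_of_fisher (hFD : FisherDominationV) (hFG : FisherGaussianityV) :
    InfraredMinimumUncertaintyNamed := by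
  intro v hv₁ hv₂ hv₃ hv₄
  obtain ⟨C₁, hC₁, ρ₁, hρ₁, h₁⟩ := hFD v hv₁ hv₂ hv₃ hv₄
  obtain ⟨C₂, hC₂, ρ₂, hρ₂, h₂⟩ := hFG v hv₁ hv₂ hv₃ hv₄
  refine ⟨C₁ * C₂ / 16, by positivity, min ρ₁ ρ₂, lt_min hρ₁ hρ₂, fun ρ hρ hρ₀ => ?_⟩
  filter_upwards [h₁ ρ hρ (lt_of_lt_of_le hρ₀ (min_le_left _ _)),
    h₂ ρ hρ (lt_of_lt_of_le hρ₀ (min_le_right _ _))] with n hn₁ hn₂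
  intro Ψ hE hfin hreal hpos m hm
  obtain ⟨φ, hφ, hFDm⟩ := hn₁ Ψ hE hfin hreal hpos m hm
  have hFGm := hn₂ Ψ hE hfin hreal hpos m hm φ hφ
  have hNS := mul_structureFactor_nonneg n (sideLength ρ (n + 1)) Ψ m
  have key : 16 * levyWeight n (sideLength ρ (n + 1)) Ψ m *
      (((n : ℝ) + 1) * structureFactor n (sideLength ρ (n + 1)) Ψ m) ≤ C₁ * C₂ :=
    calc 16 * levyWeight n (sideLength ρ (n + 1)) Ψ m *
          (((n : ℝ) + 1) * structureFactor n (sideLength ρ (n + 1)) Ψ m)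
        ≤ C₁ * fisherTestV n (sideLength ρ (n + 1)) Ψ m φ *
          (((n : ℝ) + 1) * structureFactor n (sideLength ρ (n + 1)) Ψ m) :=
          mul_le_mul_of_nonneg_right hFDm hNS
      _ = C₁ * (fisherTestV n (sideLength ρ (n + 1)) Ψ m φ *
          (((n : ℝ) + 1) * structureFactor n (sideLength ρ (n + 1)) Ψ m)) := by ring
      _ ≤ C₁ * C₂ := mul_le_mul_of_nonneg_left hFGm hC₁
  nlinarith [key]

/-- **FD(C) ⇒ DMD(C)** (the Fisher rung of the ladder, via `fisherTestV_le_secondMoment`):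
`16 ν ≤ C J(φ) ≤ 4C m₂/(N²‖k‖⁴)`. -/
theorem densityMoment_of_fisherDomination (hFD : FisherDominationV) : DensityMomentDomination := by
  intro v hv₁ hv₂ hv₃ hv₄
  obtain ⟨C₁, hC₁, ρ₁, hρ₁, h₁⟩ := hFD v hv₁ hv₂ hv₃ hv₄
  refine ⟨C₁, hC₁, ρ₁, hρ₁, fun ρ hρ hρ₀ => ?_⟩
  filter_upwards [h₁ ρ hρ hρ₀] with n hn₁
  intro Ψ hE hfin hreal hpos m hm
  obtain ⟨φ, hφ, hFDm⟩ := hn₁ Ψ hE hfin hreal hpos m hm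
  have hL := sideLength_succ_pos hρ n
  have hk := norm_waveVec_pos hL hm
  set P : ℝ := ((n : ℝ) + 1) ^ 2 * ‖waveVec (sideLength ρ (n + 1)) m‖ ^ 4 with hP_def
  have hP : 0 < P := by positivity
  have hJ := fisherTestV_le_secondMoment n (sideLength ρ (n + 1)) Ψ m hφ
  have hm₂ := secondMoment_nonneg (n + 1) (sideLength ρ (n + 1)) Ψ.ψ m
  -- 16 ν ≤ C₁ J ≤ C₁ (4/P) m₂
  have h2 : 16 * levyWeight n (sideLength ρ (n + 1)) Ψ m ≤ C₁ * (4 / P * secondMoment (n + 1) (sideLength ρ (n + 1)) Ψ.ψ m) :=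
    hFDm.trans (mul_le_mul_of_nonneg_left hJ hC₁)
  rw [show C₁ * (4 / P * secondMoment (n + 1) (sideLength ρ (n + 1)) Ψ.ψ m) =
      (4 * C₁ * secondMoment (n + 1) (sideLength ρ (n + 1)) Ψ.ψ m) / P by ring, le_div_iff₀ hP] at h2
  have hid : 4 * ((n : ℝ) + 1) ^ 2 * ‖waveVec (sideLength ρ (n + 1)) m‖ ^ 4 *
      levyWeight n (sideLength ρ (n + 1)) Ψ m = 4 * P * levyWeight n (sideLength ρ (n + 1)) Ψ m := by
    rw [hP_def]; ring
  rw [hid]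
  nlinarith [h2]

/-- **FS(C) ⇒ FG(4C)**: `J(φ)·(N S) ≤ (4m₂/(N²‖k‖⁴))·(N S) ≤ 4C`. -/
theorem fisherGaussianity_of_feynmanSaturation (hF : FeynmanSaturation) : FisherGaussianityV := by
  intro v hv₁ hv₂ hv₃ hv₄
  obtain ⟨C₁, hC₁, ρ₁, hρ₁, h₁⟩ := hF v hv₁ hv₂ hv₃ hv₄
  refine ⟨4 * C₁, by positivity, ρ₁, hρ₁, fun ρ hρ hρ₀ => ?_⟩
  filter_upwards [h₁ ρ hρ hρ₀] with n hn₁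
  intro Ψ hE hfin hreal hpos m hm φ hφ
  have hFm := hn₁ Ψ hE hfin hreal hpos m hm
  have hL := sideLength_succ_pos hρ n
  have hk := norm_waveVec_pos hL hm
  set P : ℝ := ((n : ℝ) + 1) ^ 2 * ‖waveVec (sideLength ρ (n + 1)) m‖ ^ 4 with hP_def
  have hP : 0 < P := by positivity
  have hJ := fisherTestV_le_secondMoment n (sideLength ρ (n + 1)) Ψ m hφ
  have hNS := mul_structureFactor_nonneg n (sideLength ρ (n + 1)) Ψ m
  have hm₂ := secondMoment_nonneg (n + 1) (sideLength ρ (n + 1)) Ψ.ψ m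
  calc fisherTestV n (sideLength ρ (n + 1)) Ψ m φ *
        (((n : ℝ) + 1) * structureFactor n (sideLength ρ (n + 1)) Ψ m)
      ≤ (4 / P * secondMoment (n + 1) (sideLength ρ (n + 1)) Ψ.ψ m) *
        (((n : ℝ) + 1) * structureFactor n (sideLength ρ (n + 1)) Ψ m) :=
        mul_le_mul_of_nonneg_right hJ hNS
    _ = 4 / P * ((((n : ℝ) + 1) * structureFactor n (sideLength ρ (n + 1)) Ψ m) *
        secondMoment (n + 1) (sideLength ρ (n + 1)) Ψ.ψ m) := by ring
    _ ≤ 4 / P * (C₁ * P) := mul_le_mul_of_nonneg_left hFm (by positivity)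
    _ = 4 * C₁ := by field_simp

/-- **SMB(C₁) ∧ SFC(C₂) ⇒ FS(C₁C₂)**: `(N S) m₂ ≤ (N C₂‖k‖/√(‖k‖²+ρ)) (C₁ N ‖k‖³ √(‖k‖²+ρ)) = C₁C₂ N²‖k‖⁴`. -/
theorem feynmanSaturation_of_moments (hM : SecondMomentBound) (hS : StructureFactorCeiling) :
    FeynmanSaturation := by
  intro v hv₁ hv₂ hv₃ hv₄
  obtain ⟨C₁, hC₁, ρ₁, hρ₁, h₁⟩ := hM v hv₁ hv₂ hv₃ hv₄
  obtain ⟨C₂, hC₂, ρ₂, hρ₂, h₂⟩ := hS v hv₁ hv₂ hv₃ hv₄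
  refine ⟨C₁ * C₂, by positivity, min ρ₁ ρ₂, lt_min hρ₁ hρ₂, fun ρ hρ hρ₀ => ?_⟩
  filter_upwards [h₁ ρ hρ (lt_of_lt_of_le hρ₀ (min_le_left _ _)),
    h₂ ρ hρ (lt_of_lt_of_le hρ₀ (min_le_right _ _))] with n hn₁ hn₂
  intro Ψ hE hfin hreal hpos m hm
  have hMm := hn₁ Ψ hE hfin hreal hpos m hm
  have hSm := hn₂ Ψ hE hfin hreal hpos m hm
  have hL := sideLength_succ_pos hρ n
  have hk := norm_waveVec_pos hL hm
  set κ : ℝ := ‖waveVec (sideLength ρ (n + 1)) m‖ with hκ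
  set N : ℝ := (n : ℝ) + 1 with hN
  have hNpos : 0 < N := by positivity
  have hs : 0 < Real.sqrt (κ ^ 2 + ρ) := Real.sqrt_pos.mpr (by positivity)
  have hm₂ := secondMoment_nonneg (n + 1) (sideLength ρ (n + 1)) Ψ.ψ m
  have hNS : N * structureFactor n (sideLength ρ (n + 1)) Ψ m ≤ N * (C₂ * κ / Real.sqrt (κ ^ 2 + ρ)) :=
    mul_le_mul_of_nonneg_left hSm hNpos.le
  have hNS0 := mul_structureFactor_nonneg n (sideLength ρ (n + 1)) Ψ m
  calc N * structureFactor n (sideLength ρ (n + 1)) Ψ m * secondMoment (n + 1) (sideLength ρ (n + 1)) Ψ.ψ m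
      ≤ (N * (C₂ * κ / Real.sqrt (κ ^ 2 + ρ))) * (C₁ * N * κ ^ 3 * Real.sqrt (κ ^ 2 + ρ)) :=
        mul_le_mul hNS hMm hm₂ (by positivity)
    _ = C₁ * C₂ * (N ^ 2 * κ ^ 4) := by
        field_simp

/-- **DMD(C₁) ∧ FS(C₂) ⇒ IMU(C₁C₂/4)** (the moment cut of the ladder):
`4N²‖k‖⁴ ν (N S) ≤ C₁ m₂ (N S) ≤ C₁ C₂ N²‖k‖⁴`. -/
theorem imu_of_densityMoment (hD : DensityMomentDomination) (hF : FeynmanSaturation) :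
    InfraredMinimumUncertaintyNamed := by
  intro v hv₁ hv₂ hv₃ hv₄
  obtain ⟨C₁, hC₁, ρ₁, hρ₁, h₁⟩ := hD v hv₁ hv₂ hv₃ hv₄
  obtain ⟨C₂, hC₂, ρ₂, hρ₂, h₂⟩ := hF v hv₁ hv₂ hv₃ hv₄
  refine ⟨C₁ * C₂ / 4, by positivity, min ρ₁ ρ₂, lt_min hρ₁ hρ₂, fun ρ hρ hρ₀ => ?_⟩
  filter_upwards [h₁ ρ hρ (lt_of_lt_of_le hρ₀ (min_le_left _ _)),
    h₂ ρ hρ (lt_of_lt_of_le hρ₀ (min_le_right _ _))] with n hn₁ hn₂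
  intro Ψ hE hfin hreal hpos m hm
  have hDm := hn₁ Ψ hE hfin hreal hpos m hm
  have hFm := hn₂ Ψ hE hfin hreal hpos m hm
  have hL := sideLength_succ_pos hρ n
  have hk := norm_waveVec_pos hL hm
  set P : ℝ := ((n : ℝ) + 1) ^ 2 * ‖waveVec (sideLength ρ (n + 1)) m‖ ^ 4 with hP_def
  have hP : 0 < P := by positivity
  have hNS := mul_structureFactor_nonneg n (sideLength ρ (n + 1)) Ψ m
  have hm₂ := secondMoment_nonneg (n + 1) (sideLength ρ (n + 1)) Ψ.ψ m
  -- 4 P ν ≤ C₁ m₂  ⇒  4 P ν (N S) ≤ C₁ m₂ (N S) ≤ C₁ C₂ P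
  have h3 : 4 * P * levyWeight n (sideLength ρ (n + 1)) Ψ m *
      (((n : ℝ) + 1) * structureFactor n (sideLength ρ (n + 1)) Ψ m) ≤ C₁ * C₂ * P := by
    calc 4 * P * levyWeight n (sideLength ρ (n + 1)) Ψ m *
          (((n : ℝ) + 1) * structureFactor n (sideLength ρ (n + 1)) Ψ m)
        ≤ C₁ * secondMoment (n + 1) (sideLength ρ (n + 1)) Ψ.ψ m *
          (((n : ℝ) + 1) * structureFactor n (sideLength ρ (n + 1)) Ψ m) := by
          have : 4 * P * levyWeight n (sideLength ρ (n + 1)) Ψ m =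
              4 * ((n : ℝ) + 1) ^ 2 * ‖waveVec (sideLength ρ (n + 1)) m‖ ^ 4 *
                levyWeight n (sideLength ρ (n + 1)) Ψ m := by rw [hP_def]; ring
          rw [this]
          exact mul_le_mul_of_nonneg_right hDm hNS
      _ = C₁ * ((((n : ℝ) + 1) * structureFactor n (sideLength ρ (n + 1)) Ψ m) *
          secondMoment (n + 1) (sideLength ρ (n + 1)) Ψ.ψ m) := by ring
      _ ≤ C₁ * (C₂ * P) := mul_le_mul_of_nonneg_left hFm hC₁
      _ = C₁ * C₂ * P := by ring
  have h4 : 4 * P * (((n : ℝ) + 1) * levyWeight n (sideLength ρ (n + 1)) Ψ m *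
      structureFactor n (sideLength ρ (n + 1)) Ψ m) ≤ 4 * P * (C₁ * C₂ / 4) := by
    have : 4 * P * (((n : ℝ) + 1) * levyWeight n (sideLength ρ (n + 1)) Ψ m *
        structureFactor n (sideLength ρ (n + 1)) Ψ m) =
        4 * P * levyWeight n (sideLength ρ (n + 1)) Ψ m *
          (((n : ℝ) + 1) * structureFactor n (sideLength ρ (n + 1)) Ψ m) := by ring
    rw [this]
    linarith [h3]
  exact le_of_mul_le_mul_left h4 (by positivity)


/-- SMB ∧ SFC ⇒ FG (the density-side residual of the registered cut follows from the moment bounds). -/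
theorem fisherGaussianity_of_moments (hM : SecondMomentBound) (hS : StructureFactorCeiling) :
    FisherGaussianityV :=
  fisherGaussianity_of_feynmanSaturation (feynmanSaturation_of_moments hM hS)

/-- DMD ∧ SMB ∧ SFC ⇒ IMU (the three-stub moment cut). -/
theorem imu_of_moments (hD : DensityMomentDomination) (hM : SecondMomentBound)
    (hS : StructureFactorCeiling) : InfraredMinimumUncertaintyNamed :=
  imu_of_densityMoment hD (feynmanSaturation_of_moments hM hS)

/-- FD ∧ FS ⇒ IMU and FD ∧ SMB ∧ SFC ⇒ IMU (dominated cuts, recorded for completeness). -/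
theorem imu_of_fisherDomination_of_feynmanSaturation (hFD : FisherDominationV)
    (hF : FeynmanSaturation) : InfraredMinimumUncertaintyNamed :=
  imu_of_fisher hFD (fisherGaussianity_of_feynmanSaturation hF)


/-- **The Stein identity turns `J` into its derivative-free form**: for a real state, a `C¹` field and
`m ≠ 0`, `fisherTestV = steinFunctional` (inline right-hand side). -/
theorem fisherTestV_eq_stein (hS : SteinIdentity) {n : ℕ} {L : ℝ} (hL : 0 < L)
    (Ψ : PeriodicTrialState (n + 1) L) (hreal : ∀ X, Ψ.ψ X = (‖Ψ.ψ X‖ : ℂ))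
    {m : Fin 3 → ℤ} (hm : m ≠ 0) {φ : ℂ → ℂ} (hφ : ContDiff ℝ 1 φ) :
    fisherTestV n L Ψ m φ =
      -(4 / ((n : ℝ) + 1)) *
          (∫ X in cellN (n + 1) L,
            ((((n : ℝ) + 1 : ℝ) : ℂ) *
                ((fderiv ℝ φ (∑ j : Fin (n + 1), cellWave L m (X j)) 1 -
                    Complex.I * fderiv ℝ φ (∑ j : Fin (n + 1), cellWave L m (X j)) Complex.I) / 2) -
              (fderiv ℝ φ (∑ j : Fin (n + 1), cellWave L m (X j)) 1 +
                    Complex.I * fderiv ℝ φ (∑ j : Fin (n + 1), cellWave L m (X j)) Complex.I) / 2 *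
                starRingEnd ℂ (∑ j : Fin (n + 1), cellWave L m (X j) ^ 2)).re * ‖Ψ.ψ X‖ ^ 2) -
        ∫ X in cellN (n + 1) L, ‖φ (∑ j : Fin (n + 1), cellWave L m (X j))‖ ^ 2 * ‖Ψ.ψ X‖ ^ 2 := by
  have hk := norm_waveVec_pos hL hm
  have hN : (0 : ℝ) < (n : ℝ) + 1 := by positivity
  have hP : (∫ X in cellN (n + 1) L, (starRingEnd ℂ (φ (densityMode (n + 1) L m X)) *
      commutatorAmp (n + 1) L Ψ.ψ m X * starRingEnd ℂ (Ψ.ψ X)).re) =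
      ‖waveVec L m‖ ^ 2 * ∫ X in cellN (n + 1) L,
            ((((n : ℝ) + 1 : ℝ) : ℂ) *
                ((fderiv ℝ φ (∑ j : Fin (n + 1), cellWave L m (X j)) 1 -
                    Complex.I * fderiv ℝ φ (∑ j : Fin (n + 1), cellWave L m (X j)) Complex.I) / 2) -
              (fderiv ℝ φ (∑ j : Fin (n + 1), cellWave L m (X j)) 1 +
                    Complex.I * fderiv ℝ φ (∑ j : Fin (n + 1), cellWave L m (X j)) Complex.I) / 2 *
                starRingEnd ℂ (∑ j : Fin (n + 1), cellWave L m (X j) ^ 2)).re * ‖Ψ.ψ X‖ ^ 2 :=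
    hS n L hL Ψ hreal m φ hφ
  unfold fisherTestV
  rw [hP]
  unfold densityMode
  field_simp

/-- **The lemma-exposing cut of FD**: SteinIdentity ∧ WeakEulerLagrange ∧ CoherenceRegular ∧
PhaseSteinDomination ⇒ FisherDominationV (same constant `C`, same `ρ₀`; the `C¹` witness field is
continuous). -/
theorem fisherDominationV_of_parts (hS : SteinIdentity) (hEL : WeakEulerLagrange)
    (hG : CoherenceRegular) (hP : PhaseSteinDomination) : FisherDominationV := by
  intro v hv₁ hv₂ hv₃ hv₄
  obtain ⟨C, hC, ρ₀, hρ₀, h⟩ := hP v hv₁ hv₂ hv₃ hv₄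
  refine ⟨C, hC, ρ₀, hρ₀, fun ρ hρ hρ' => ?_⟩
  filter_upwards [h ρ hρ hρ'] with n hn
  intro Ψ hE hfin hreal hpos m hm
  have hL := sideLength_succ_pos hρ n
  have hELΨ := hEL v hv₁ hv₂ hv₃ hv₄ n (sideLength ρ (n + 1)) hL Ψ hE hfin
  obtain ⟨hgc, hgpos, -, -, -, -⟩ := hG n (sideLength ρ (n + 1)) hL Ψ hpos
  obtain ⟨φ, hφ, hbound⟩ := hn Ψ hE hfin hreal hpos hELΨ hgc hgpos m hm
  refine ⟨φ, hφ.continuous, ?_⟩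
  rw [fisherTestV_eq_stein hS hL Ψ hreal hm hφ]
  exact hbound

end Compositions

/-! ## The skeleton concludes the crux BY NAME -/

/-- **`InfraredMinimumUncertainty`** (route `BECConjugateDomination`, stmt-AtomisticToContinuum-11784)
from the two registered stubs — the ONLY theorem of this file concluding the route decl by name. -/
theorem InfraredMinimumUncertainty_of : InfraredMinimumUncertainty :=
  infraredMinimumUncertainty_iff_named.mp
    (imu_of_fisher
      (fisherDominationV_of_parts stub_steinIdentity stub_weakEulerLagrange stub_coherenceRegular
        stub_phaseSteinDomination)
      stub_densityFisherGaussianity)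

/-! ## Necessity of the waypoints — the Cramér–Rao rung

`IMU(C₀) ⇒ FD(4C₀ + 4) ⇒ DMD(4C₀ + 4)`: the linear test field `φ_λ(z) = −λz` has
`J(φ_λ) = (4λ/(N‖k‖²))·Re∫Z̄WΨ̄ − λ²·N S = 4λ − λ²·N S` by the f-sum identity, hence
`sup_λ J(φ_λ) = 4/(N S)` (at `λ = 2/(N S)`), the planar Cramér–Rao value for the UNCENTRED second
moment. So FD and DMD are genuine waypoints: no witness can refute them without refuting the crux, and
every census/heuristic backing IMU backs them. The only input is `FSumIdentity`, the f-sum rule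
`⟨ρ_k† [H, ρ_k]⟩ = N‖k‖²` for real periodic `C¹` states, PROVED above (`fSumIdentity_holds`), so both
necessity theorems are UNCONDITIONAL and sorry-free. -/

/-- **The f-sum identity** `Re ∫_{cell^N} Z̄_m W_m Ψ̄ dX = N‖k‖²` for a real-valued normalised periodic
`C¹` state (`⟨ρ_k Ψ, [H,ρ_k] Ψ⟩ = ½⟨[ρ_k†,[H,ρ_k]]⟩ = N‖k‖²`). Proof on paper: with `Ψ = u` real,
`Re(Z̄ W u) = ‖k‖² u² |Z|² + ∑ⱼ Im(Z̄ eⱼ) ∂_{xⱼ·k}(u²)`; integrate the second term by parts on the torus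
(`integral_cellN_pderiv_eq_zero`) using `∂_{xⱼ·k}(Z̄ eⱼ) = −i‖k‖² + i‖k‖² Z̄ eⱼ`, which gives
`‖k‖² N − ‖k‖² ∫u²|Z|²`, and add. Size S/M (calculus over `pderiv`, `hasFDerivAt_cellWave`). -/
def FSumIdentity : Prop :=
  ∀ (n : ℕ) (L : ℝ), 0 < L → ∀ Ψ : PeriodicTrialState (n + 1) L, (∀ X, Ψ.ψ X = (‖Ψ.ψ X‖ : ℂ)) →
    ∀ m : Fin 3 → ℤ,
      (∫ X in cellN (n + 1) L, (starRingEnd ℂ (densityMode (n + 1) L m X) *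
        commutatorAmp (n + 1) L Ψ.ψ m X * starRingEnd ℂ (Ψ.ψ X)).re) = ((n : ℝ) + 1) * ‖waveVec L m‖ ^ 2

/-- The f-sum identity holds (`fSumIdentity_holds`). -/
theorem fSumIdentity : FSumIdentity := fun n L hL Ψ hreal m => fSumIdentity_holds n L hL Ψ hreal m

/-- **The Cramér–Rao computation**: `J(φ_λ) = 4λ − λ² · N S_m` for the linear field `φ_λ(z) = −λz`. -/
theorem fisherTestV_linear {n : ℕ} {L : ℝ} (hL : 0 < L)
    (Ψ : PeriodicTrialState (n + 1) L) (hreal : ∀ X, Ψ.ψ X = (‖Ψ.ψ X‖ : ℂ))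
    {m : Fin 3 → ℤ} (hm : m ≠ 0) (lam : ℝ) :
    fisherTestV n L Ψ m (fun z => -(lam : ℂ) * z) =
      4 * lam - lam ^ 2 * ∫ X in cellN (n + 1) L, ‖densityMode (n + 1) L m X‖ ^ 2 * ‖Ψ.ψ X‖ ^ 2 := by
  have hk := norm_waveVec_pos hL hm
  have hN : (0 : ℝ) < (n : ℝ) + 1 := by positivity
  have h1 : ∀ X : Config (n + 1),
      (starRingEnd ℂ (-(lam : ℂ) * densityMode (n + 1) L m X) * commutatorAmp (n + 1) L Ψ.ψ m X *
        starRingEnd ℂ (Ψ.ψ X)).re =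
      -lam * (starRingEnd ℂ (densityMode (n + 1) L m X) * commutatorAmp (n + 1) L Ψ.ψ m X *
        starRingEnd ℂ (Ψ.ψ X)).re := by
    intro X
    rw [map_mul, map_neg, Complex.conj_ofReal]
    simp only [neg_mul, mul_assoc, Complex.neg_re, Complex.re_ofReal_mul]
  have h2 : ∀ X : Config (n + 1),
      ‖-(lam : ℂ) * densityMode (n + 1) L m X‖ ^ 2 * ‖Ψ.ψ X‖ ^ 2 =
        lam ^ 2 * (‖densityMode (n + 1) L m X‖ ^ 2 * ‖Ψ.ψ X‖ ^ 2) := by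
    intro X
    rw [norm_mul, norm_neg, Complex.norm_real, Real.norm_eq_abs, mul_pow, sq_abs]
    ring
  unfold fisherTestV
  simp_rw [h1, h2]
  rw [integral_const_mul, integral_const_mul, fSumIdentity n L hL Ψ hreal m]
  field_simp

/-- **IMU ⇒ FD** with `C = 4C₀ + 4`, the witness being the linear field at `λ = 2/(N S_m)`
(or `λ = |ν_m|` in the degenerate case `N S_m = 0`). Unconditional. -/
theorem fisherDomination_of_imu (h : InfraredMinimumUncertainty) : FisherDominationV := by
  intro v hv₁ hv₂ hv₃ hv₄
  obtain ⟨C₀, hC₀, ρ₀, hρ₀, h₀⟩ := h v hv₁ hv₂ hv₃ hv₄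
  refine ⟨4 * C₀ + 4, by positivity, ρ₀, hρ₀, fun ρ hρ hρ' => ?_⟩
  filter_upwards [h₀ ρ hρ hρ'] with n hn
  intro Ψ hE hfin hreal hpos m hm
  have hL := sideLength_succ_pos hρ n
  have himu : ((n : ℝ) + 1) * levyWeight n (sideLength ρ (n + 1)) Ψ m *
      structureFactor n (sideLength ρ (n + 1)) Ψ m ≤ C₀ := hn Ψ hE hfin hreal hpos m hm
  have hA0 : 0 ≤ ∫ X in cellN (n + 1) (sideLength ρ (n + 1)),
      ‖densityMode (n + 1) (sideLength ρ (n + 1)) m X‖ ^ 2 * ‖Ψ.ψ X‖ ^ 2 :=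
    integral_nonneg fun X => by positivity
  have hNS : ((n : ℝ) + 1) * structureFactor n (sideLength ρ (n + 1)) Ψ m =
      ∫ X in cellN (n + 1) (sideLength ρ (n + 1)),
        ‖densityMode (n + 1) (sideLength ρ (n + 1)) m X‖ ^ 2 * ‖Ψ.ψ X‖ ^ 2 := by
    unfold structureFactor densityMode
    rw [← mul_assoc, mul_inv_cancel₀ (by positivity), one_mul]
  have hνA : levyWeight n (sideLength ρ (n + 1)) Ψ m *
      (∫ X in cellN (n + 1) (sideLength ρ (n + 1)),
        ‖densityMode (n + 1) (sideLength ρ (n + 1)) m X‖ ^ 2 * ‖Ψ.ψ X‖ ^ 2) ≤ C₀ := by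
    rw [← hNS]
    have : ((n : ℝ) + 1) * levyWeight n (sideLength ρ (n + 1)) Ψ m *
        structureFactor n (sideLength ρ (n + 1)) Ψ m =
        levyWeight n (sideLength ρ (n + 1)) Ψ m *
          (((n : ℝ) + 1) * structureFactor n (sideLength ρ (n + 1)) Ψ m) := by ring
    rw [this] at himu
    exact himu
  have hJ : ∀ lam : ℝ, fisherTestV n (sideLength ρ (n + 1)) Ψ m (fun z => -(lam : ℂ) * z) =
      4 * lam - lam ^ 2 * ∫ X in cellN (n + 1) (sideLength ρ (n + 1)),
        ‖densityMode (n + 1) (sideLength ρ (n + 1)) m X‖ ^ 2 * ‖Ψ.ψ X‖ ^ 2 :=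
    fun lam => fisherTestV_linear hL Ψ hreal hm lam
  have hcont : ∀ lam : ℝ, Continuous (fun z : ℂ => -(lam : ℂ) * z) := fun lam =>
    continuous_const.mul continuous_id
  generalize hA : (∫ X in cellN (n + 1) (sideLength ρ (n + 1)),
      ‖densityMode (n + 1) (sideLength ρ (n + 1)) m X‖ ^ 2 * ‖Ψ.ψ X‖ ^ 2) = A at hA0 hνA hJ
  generalize hν : levyWeight n (sideLength ρ (n + 1)) Ψ m = ν at hνA ⊢
  by_cases hApos : 0 < A
  · refine ⟨fun z => -((2 / A : ℝ) : ℂ) * z, hcont _, ?_⟩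
    rw [hJ, show 4 * (2 / A) - (2 / A) ^ 2 * A = 4 / A by field_simp; ring,
      show (4 * C₀ + 4) * (4 / A) = (16 * (C₀ + 1)) / A by ring, le_div_iff₀ hApos]
    have : 16 * ν * A = 16 * (ν * A) := by ring
    rw [this]
    linarith
  · have hA_eq : A = 0 := le_antisymm (not_lt.mp hApos) hA0
    refine ⟨fun z => -((|ν| : ℝ) : ℂ) * z, hcont _, ?_⟩
    rw [hJ, hA_eq]
    simp only [mul_zero, sub_zero]
    nlinarith [le_abs_self ν, abs_nonneg ν, mul_nonneg hC₀ (abs_nonneg ν)]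

/-- **IMU ⇒ DMD** (the sibling card's waypoint is necessary too). Unconditional. -/
theorem densityMoment_of_imu (h : InfraredMinimumUncertainty) : DensityMomentDomination :=
  densityMoment_of_fisherDomination (fisherDomination_of_imu h)

/-! ## Inline (self-contained) forms of the statements, certified

The registered stub signatures ARE the named statements (`Iff.rfl`: the expanded text is, up to
delta reduction, the body of `waveVec`, `densityMode`, `commutatorAmp`, `secondMoment`, `coherence`,
`levyWeight`, `structureFactor`, `fisherTestV` inside `CruxFrame`). The four fallback statements are
given in the same self-contained let-free form, so that the lead can re-register a fallback cut by
copying the left-hand side into `theorem stub_<name> : <inline form> := by sorry` (and composing with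
the proved glue above: `imu_of_densityMoment`, `imu_of_moments`, `fisherGaussianity_of_moments`). -/

section InlineForms

theorem fisherDominationV_iff_inline :
    (∀ v : ℝ → ℝ≥0∞, IsRepulsiveFiniteRange v → (∀ r, v r ≠ ⊤) →
      ContDiff ℝ 2 (fun x : Space => (v ‖x‖).toReal) →
      (∃ Cₑ : ℝ, ∀ x : Space,
        ‖iteratedFDeriv ℝ 2 (fun x : Space => (v ‖x‖).toReal) x‖ ≤ Cₑ * Real.sqrt ((v ‖x‖).toReal)) →
      ∃ C : ℝ, 0 ≤ C ∧ ∃ ρ₀ : ℝ, 0 < ρ₀ ∧ ∀ ρ : ℝ, 0 < ρ → ρ < ρ₀ → ∀ᶠ n : ℕ in Filter.atTop,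
        ∀ Ψ : PeriodicTrialState (n + 1) (sideLength ρ (n + 1)),
          periodicEnergy v Ψ = periodicGroundStateEnergy v (n + 1) (sideLength ρ (n + 1)) →
          periodicEnergy v Ψ ≠ ⊤ → (∀ X, Ψ.ψ X = (‖Ψ.ψ X‖ : ℂ)) → (∀ X, Ψ.ψ X ≠ 0) →
          ∀ m : Fin 3 → ℤ, m ≠ 0 →
            ∃ φ : ℂ → ℂ, Continuous φ ∧
              16 * (cellFourierCoeff (sideLength ρ (n + 1)) (fun r : Space => ((Real.log
                (∫ x in cell (sideLength ρ (n + 1)), ∫ Y in cellN n (sideLength ρ (n + 1)),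
                  ‖Ψ.ψ (Matrix.vecCons (x + r) Y)‖ * ‖Ψ.ψ (Matrix.vecCons x Y)‖) : ℝ) : ℂ)) m).re ≤
              C * (-(4 / (((n : ℝ) + 1) * ‖((2 * Real.pi / sideLength ρ (n + 1)) • latticeVec 1 m)‖ ^ 2)) *
                (∫ X in cellN (n + 1) (sideLength ρ (n + 1)), (starRingEnd ℂ (φ (∑ j : Fin (n + 1), cellWave (sideLength ρ (n + 1)) m (X j))) *
                  (∑ j : Fin (n + 1), cellWave (sideLength ρ (n + 1)) m (X j) *
                (((‖((2 * Real.pi / sideLength ρ (n + 1)) • latticeVec 1 m)‖ ^ 2 : ℝ) : ℂ) * Ψ.ψ X -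
                  2 * Complex.I * fderiv ℝ Ψ.ψ X (Pi.single j ((2 * Real.pi / sideLength ρ (n + 1)) • latticeVec 1 m)))) * starRingEnd ℂ (Ψ.ψ X)).re) -
              ∫ X in cellN (n + 1) (sideLength ρ (n + 1)), ‖φ (∑ j : Fin (n + 1), cellWave (sideLength ρ (n + 1)) m (X j))‖ ^ 2 * ‖Ψ.ψ X‖ ^ 2)) ↔ FisherDominationV :=
  Iff.rfl

theorem fisherGaussianityV_iff_inline :
    (∀ v : ℝ → ℝ≥0∞, IsRepulsiveFiniteRange v → (∀ r, v r ≠ ⊤) →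
      ContDiff ℝ 2 (fun x : Space => (v ‖x‖).toReal) →
      (∃ Cₑ : ℝ, ∀ x : Space,
        ‖iteratedFDeriv ℝ 2 (fun x : Space => (v ‖x‖).toReal) x‖ ≤ Cₑ * Real.sqrt ((v ‖x‖).toReal)) →
      ∃ C : ℝ, 0 ≤ C ∧ ∃ ρ₀ : ℝ, 0 < ρ₀ ∧ ∀ ρ : ℝ, 0 < ρ → ρ < ρ₀ → ∀ᶠ n : ℕ in Filter.atTop,
        ∀ Ψ : PeriodicTrialState (n + 1) (sideLength ρ (n + 1)),
          periodicEnergy v Ψ = periodicGroundStateEnergy v (n + 1) (sideLength ρ (n + 1)) →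
          periodicEnergy v Ψ ≠ ⊤ → (∀ X, Ψ.ψ X = (‖Ψ.ψ X‖ : ℂ)) → (∀ X, Ψ.ψ X ≠ 0) →
          ∀ m : Fin 3 → ℤ, m ≠ 0 →
            ∀ φ : ℂ → ℂ, Continuous φ →
              (-(4 / (((n : ℝ) + 1) * ‖((2 * Real.pi / sideLength ρ (n + 1)) • latticeVec 1 m)‖ ^ 2)) *
                (∫ X in cellN (n + 1) (sideLength ρ (n + 1)), (starRingEnd ℂ (φ (∑ j : Fin (n + 1), cellWave (sideLength ρ (n + 1)) m (X j))) *
                  (∑ j : Fin (n + 1), cellWave (sideLength ρ (n + 1)) m (X j) *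
                (((‖((2 * Real.pi / sideLength ρ (n + 1)) • latticeVec 1 m)‖ ^ 2 : ℝ) : ℂ) * Ψ.ψ X -
                  2 * Complex.I * fderiv ℝ Ψ.ψ X (Pi.single j ((2 * Real.pi / sideLength ρ (n + 1)) • latticeVec 1 m)))) * starRingEnd ℂ (Ψ.ψ X)).re) -
              ∫ X in cellN (n + 1) (sideLength ρ (n + 1)), ‖φ (∑ j : Fin (n + 1), cellWave (sideLength ρ (n + 1)) m (X j))‖ ^ 2 * ‖Ψ.ψ X‖ ^ 2) *
              (((n : ℝ) + 1) * (((n : ℝ) + 1)⁻¹ * ∫ X in cellN (n + 1) (sideLength ρ (n + 1)),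
                ‖∑ j : Fin (n + 1), cellWave (sideLength ρ (n + 1)) m (X j)‖ ^ 2 * ‖Ψ.ψ X‖ ^ 2)) ≤ C) ↔ FisherGaussianityV :=
  Iff.rfl

theorem densityMomentDomination_iff_inline :
    (∀ v : ℝ → ℝ≥0∞, IsRepulsiveFiniteRange v → (∀ r, v r ≠ ⊤) →
      ContDiff ℝ 2 (fun x : Space => (v ‖x‖).toReal) →
      (∃ Cₑ : ℝ, ∀ x : Space,
        ‖iteratedFDeriv ℝ 2 (fun x : Space => (v ‖x‖).toReal) x‖ ≤ Cₑ * Real.sqrt ((v ‖x‖).toReal)) →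
      ∃ C : ℝ, 0 ≤ C ∧ ∃ ρ₀ : ℝ, 0 < ρ₀ ∧ ∀ ρ : ℝ, 0 < ρ → ρ < ρ₀ → ∀ᶠ n : ℕ in Filter.atTop,
        ∀ Ψ : PeriodicTrialState (n + 1) (sideLength ρ (n + 1)),
          periodicEnergy v Ψ = periodicGroundStateEnergy v (n + 1) (sideLength ρ (n + 1)) →
          periodicEnergy v Ψ ≠ ⊤ → (∀ X, Ψ.ψ X = (‖Ψ.ψ X‖ : ℂ)) → (∀ X, Ψ.ψ X ≠ 0) →
          ∀ m : Fin 3 → ℤ, m ≠ 0 →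
            4 * ((n : ℝ) + 1) ^ 2 * ‖((2 * Real.pi / sideLength ρ (n + 1)) • latticeVec 1 m)‖ ^ 4 *
              (cellFourierCoeff (sideLength ρ (n + 1)) (fun r : Space => ((Real.log
                (∫ x in cell (sideLength ρ (n + 1)), ∫ Y in cellN n (sideLength ρ (n + 1)),
                  ‖Ψ.ψ (Matrix.vecCons (x + r) Y)‖ * ‖Ψ.ψ (Matrix.vecCons x Y)‖) : ℝ) : ℂ)) m).re ≤
              C * (∫ X in cellN (n + 1) (sideLength ρ (n + 1)), ‖(∑ j : Fin (n + 1), cellWave (sideLength ρ (n + 1)) m (X j) *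
                  (((‖((2 * Real.pi / sideLength ρ (n + 1)) • latticeVec 1 m)‖ ^ 2 : ℝ) : ℂ) * Ψ.ψ X -
                    2 * Complex.I * fderiv ℝ Ψ.ψ X (Pi.single j ((2 * Real.pi / sideLength ρ (n + 1)) • latticeVec 1 m))))‖ ^ 2)) ↔ DensityMomentDomination :=
  Iff.rfl

theorem feynmanSaturation_iff_inline :
    (∀ v : ℝ → ℝ≥0∞, IsRepulsiveFiniteRange v → (∀ r, v r ≠ ⊤) →
      ContDiff ℝ 2 (fun x : Space => (v ‖x‖).toReal) →
      (∃ Cₑ : ℝ, ∀ x : Space,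
        ‖iteratedFDeriv ℝ 2 (fun x : Space => (v ‖x‖).toReal) x‖ ≤ Cₑ * Real.sqrt ((v ‖x‖).toReal)) →
      ∃ C : ℝ, 0 ≤ C ∧ ∃ ρ₀ : ℝ, 0 < ρ₀ ∧ ∀ ρ : ℝ, 0 < ρ → ρ < ρ₀ → ∀ᶠ n : ℕ in Filter.atTop,
        ∀ Ψ : PeriodicTrialState (n + 1) (sideLength ρ (n + 1)),
          periodicEnergy v Ψ = periodicGroundStateEnergy v (n + 1) (sideLength ρ (n + 1)) →
          periodicEnergy v Ψ ≠ ⊤ → (∀ X, Ψ.ψ X = (‖Ψ.ψ X‖ : ℂ)) → (∀ X, Ψ.ψ X ≠ 0) →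
          ∀ m : Fin 3 → ℤ, m ≠ 0 →
            (((n : ℝ) + 1) * (((n : ℝ) + 1)⁻¹ * ∫ X in cellN (n + 1) (sideLength ρ (n + 1)),
                ‖∑ j : Fin (n + 1), cellWave (sideLength ρ (n + 1)) m (X j)‖ ^ 2 * ‖Ψ.ψ X‖ ^ 2)) *
              (∫ X in cellN (n + 1) (sideLength ρ (n + 1)), ‖(∑ j : Fin (n + 1), cellWave (sideLength ρ (n + 1)) m (X j) *
                  (((‖((2 * Real.pi / sideLength ρ (n + 1)) • latticeVec 1 m)‖ ^ 2 : ℝ) : ℂ) * Ψ.ψ X -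
                    2 * Complex.I * fderiv ℝ Ψ.ψ X (Pi.single j ((2 * Real.pi / sideLength ρ (n + 1)) • latticeVec 1 m))))‖ ^ 2) ≤
              C * (((n : ℝ) + 1) ^ 2 * ‖((2 * Real.pi / sideLength ρ (n + 1)) • latticeVec 1 m)‖ ^ 4)) ↔ FeynmanSaturation :=
  Iff.rfl

theorem secondMomentBound_iff_inline :
    (∀ v : ℝ → ℝ≥0∞, IsRepulsiveFiniteRange v → (∀ r, v r ≠ ⊤) →
      ContDiff ℝ 2 (fun x : Space => (v ‖x‖).toReal) →
      (∃ Cₑ : ℝ, ∀ x : Space,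
        ‖iteratedFDeriv ℝ 2 (fun x : Space => (v ‖x‖).toReal) x‖ ≤ Cₑ * Real.sqrt ((v ‖x‖).toReal)) →
      ∃ C : ℝ, 0 ≤ C ∧ ∃ ρ₀ : ℝ, 0 < ρ₀ ∧ ∀ ρ : ℝ, 0 < ρ → ρ < ρ₀ → ∀ᶠ n : ℕ in Filter.atTop,
        ∀ Ψ : PeriodicTrialState (n + 1) (sideLength ρ (n + 1)),
          periodicEnergy v Ψ = periodicGroundStateEnergy v (n + 1) (sideLength ρ (n + 1)) →
          periodicEnergy v Ψ ≠ ⊤ → (∀ X, Ψ.ψ X = (‖Ψ.ψ X‖ : ℂ)) → (∀ X, Ψ.ψ X ≠ 0) →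
          ∀ m : Fin 3 → ℤ, m ≠ 0 →
            (∫ X in cellN (n + 1) (sideLength ρ (n + 1)), ‖(∑ j : Fin (n + 1), cellWave (sideLength ρ (n + 1)) m (X j) *
                  (((‖((2 * Real.pi / sideLength ρ (n + 1)) • latticeVec 1 m)‖ ^ 2 : ℝ) : ℂ) * Ψ.ψ X -
                    2 * Complex.I * fderiv ℝ Ψ.ψ X (Pi.single j ((2 * Real.pi / sideLength ρ (n + 1)) • latticeVec 1 m))))‖ ^ 2) ≤
              C * ((n : ℝ) + 1) * ‖((2 * Real.pi / sideLength ρ (n + 1)) • latticeVec 1 m)‖ ^ 3 *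
                Real.sqrt (‖((2 * Real.pi / sideLength ρ (n + 1)) • latticeVec 1 m)‖ ^ 2 + ρ)) ↔ SecondMomentBound :=
  Iff.rfl

theorem structureFactorCeiling_iff_inline :
    (∀ v : ℝ → ℝ≥0∞, IsRepulsiveFiniteRange v → (∀ r, v r ≠ ⊤) →
      ContDiff ℝ 2 (fun x : Space => (v ‖x‖).toReal) →
      (∃ Cₑ : ℝ, ∀ x : Space,
        ‖iteratedFDeriv ℝ 2 (fun x : Space => (v ‖x‖).toReal) x‖ ≤ Cₑ * Real.sqrt ((v ‖x‖).toReal)) →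
      ∃ C : ℝ, 0 ≤ C ∧ ∃ ρ₀ : ℝ, 0 < ρ₀ ∧ ∀ ρ : ℝ, 0 < ρ → ρ < ρ₀ → ∀ᶠ n : ℕ in Filter.atTop,
        ∀ Ψ : PeriodicTrialState (n + 1) (sideLength ρ (n + 1)),
          periodicEnergy v Ψ = periodicGroundStateEnergy v (n + 1) (sideLength ρ (n + 1)) →
          periodicEnergy v Ψ ≠ ⊤ → (∀ X, Ψ.ψ X = (‖Ψ.ψ X‖ : ℂ)) → (∀ X, Ψ.ψ X ≠ 0) →
          ∀ m : Fin 3 → ℤ, m ≠ 0 →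
            (((n : ℝ) + 1)⁻¹ * ∫ X in cellN (n + 1) (sideLength ρ (n + 1)),
                ‖∑ j : Fin (n + 1), cellWave (sideLength ρ (n + 1)) m (X j)‖ ^ 2 * ‖Ψ.ψ X‖ ^ 2) ≤
              C * ‖((2 * Real.pi / sideLength ρ (n + 1)) • latticeVec 1 m)‖ /
                Real.sqrt (‖((2 * Real.pi / sideLength ρ (n + 1)) • latticeVec 1 m)‖ ^ 2 + ρ)) ↔ StructureFactorCeiling :=
  Iff.rfl

end InlineForms

end Summit.AtomisticToContinuum.BoseEinsteinCondensation.Cruxes.InfraredMinimumUncertainty.FisherGaussianDensityMode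

end
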